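import Literature.Probability.Percolation.IsoradialRectangularCrossingsSS
import Literature.Probability.Percolation.IsoradialRectangularCrossingsOfSS
import Literature.Probability.Percolation.IsoradialRectangularCrossingsTransfer
import Literature.Probability.Percolation.QuadCrossingRotationCouplingFiniteQuads
import Literature.Probability.Percolation.QuadCrossingRotationInvarianceOfThm21
import HarnessLib

/-!
# DKKMO Theorem 2.1, Schramm–Smirnov half (`q = 1`): reduction to finitely many quads and to the
# printed `d_CN` theorem plus a per-quad loops-to-crossings transfer

Topic `Probability/Percolation`; proofs-only sequel of `IsoradialRectangularCrossingsSS.lean` (no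
definition, no named fact). That file vendors, as the named fact `DKKMO2020_thm21_schrammSmirnov`,
the Schramm–Smirnov (`d_SS`) half of Duminil-Copin–Kozlowski–Krachun–Manolescu–Oulamara,
*Rotational invariance in critical planar lattice models*, arXiv:2012.11672v1, Theorem 2.1 at
`q = 1`: for `ε > 0` and every open neighbourhood `N` of the diagonal of `ℋ_ℂ × ℋ_ℂ` there is
`δ₀ > 0` such that for `α ∈ (ε, π - ε)`, `0 < δ ≤ δ₀` some coupling of `φ_{δ𝕃(α)}` and
`φ_{δ𝕃(π/2)}` puts `(S^{α}_{ω}, S^{π/2}_{ω'})` outside `N` with probability `< ε`.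

Both printed proofs of this half go through the ONE universality coupling of the paper and a
passage between topologies that is only cited: v1 proves the coupling in the homotopy distance
`d_H` (Thm. 2.3) and says (proof of Thm. 2.2, §5.2 p. 25) "We show the result for the Camia–Newman
distance. The version of the result for the Schramm–Smirnov distance follows readily from known
implications between the former and the latter (see e.g. [CamNew06])"; v2 (2026, Thm. 1.7) proves
`d_CN(φ_{δ𝕃(α)}, φ_{δ𝕃(π/2)}) < C δ^c` — the tree's named fact `dkkmo_theorem_1_7`
(`LoopRepresentation.lean`, undischarged) — and adds "The statement for the `d_SS` distance follows
by [GPS13, Sec. 2.3]". This file records, kernel-checked, exactly what that passage requires in the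
tree's vocabulary. No percolation estimate on `𝕃(α)`, `α ≠ π/2`, is ever used: every error event is
charged to the reference configuration on `δ𝕃(π/2) = e^{iπ/4}√2 δℤ²`, where Schramm–Smirnov's
continuity estimate (5.1) is available (DISCHARGED in the tree: `SchrammSmirnov2011_lemma_5_1_holds`).

* `continuity_isoRectDrawing_pi_div_two` — (5.1) for critical bond percolation drawn on `δ𝕃(π/2)`
  (transport of (5.1) on `(√2 δ)ℤ²` by the rotation `e^{iπ/4}`);
* `exists_quad_event_of_piece_isoRect` — what a subbasic piece `int ⊞_Q` / `V^Q` of `𝒯` costs,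
  with the reference configuration `S^{π/2}_{ω'}` inside the piece;
* `DKKMO2020_thm21_schrammSmirnov_of_finiteQuads_of_continuity` — **the fact follows from (F):
  couplings of `φ_{δ𝕃(α)}` and `φ_{δ𝕃(π/2)}` under which the crossing indicators of finitely many
  fixed quads in `S^{α}_{ω}` and `S^{π/2}_{ω'}` agree outside an event of probability `< ε`**,
  uniformly in `α ∈ (ε, π - ε)` (the `[GPS]`-characterization step of §7.1 p. 42, by compactness of
  `ℋ_ℂ` and the subbase `int ⊞_Q`, `V^Q`, exactly as in
  `dkkmo_theorem_1_2_schrammSmirnov_of_finiteQuads_of_continuity`);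
* `finiteQuads_of_DKKMO2020_thm21_schrammSmirnov_of_continuity` — conversely the fact gives (F);
  `DKKMO2020_thm21_schrammSmirnov_iff_finiteQuads` — so the fact is EQUIVALENT to (F);
* `exists_events_of_transfer_quad`, `finiteQuads_of_transfer_of_theorem_1_7_of_continuity` — (F)
  follows from the printed Theorem 1.7 (`dkkmo_theorem_1_7`, `d_CN` form, couplings with
  `ℙ[¬ (d_CN ≤ C δ^c)] < C δ^c` uniformly in `α ∈ (0, π)`) and the per-quad loops-to-crossings
  transfer `H` of `IsoradialRectangularCrossingsTransfer.lean` (VERBATIM the hypothesis of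
  `DKKMO2020_thm21_quadCrossingProb_of_transfer`: robust crossings `G` and robust non-crossings `B`
  of a fixed conformal rectangle by the `𝕃(π/2)` configuration are transferred along `η`-close typed
  loop ensembles);
* `DKKMO2020_thm21_schrammSmirnov_of_transfer_of_theorem_1_7 : H → dkkmo_theorem_1_7 →
  DKKMO2020_thm21_schrammSmirnov` — **so the configuration-level `d_SS` fact and its per-quad
  reading `DKKMO2020_thm21_quadCrossingProb` rest on the same two inputs;**
* `finiteQuads_of_loopDetermined_of_theorem_1_7`,
  `DKKMO2020_thm21_schrammSmirnov_of_loopDetermined_of_theorem_1_7` — the minimal per-quad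
  interface (no rectangles, no (5.1)): (F), hence the fact, from Theorem 1.7 and "the crossing of
  a fixed quad is determined by the typed loop ensemble, stably, off an event of small probability
  of the `ℤ²` configuration"; `loopDetermined_of_transfer_of_continuity` — `H` + (5.1) give it;
  `finiteQuads_of_loopDetermined₂_of_theorem_1_7`,
  `DKKMO2020_thm21_schrammSmirnov_of_loopDetermined₂_of_theorem_1_7` — the same with bad events
  on BOTH configurations and angles in a window `(ε', π - ε')` (room for percolation estimates on
  `𝕃(α)` uniform over bounded angles), `loopDetermined₂_of_loopDetermined`.

## References

* [DKKMO2020Rotational] H. Duminil-Copin, K. K. Kozlowski, D. Krachun, I. Manolescu, M. Oulamara,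
  arXiv:2012.11672v1 (2020): §1.2 p. 4 (`ℋ`, `d_SS`), Thm. 2.1–2.3 pp. 7–8, §5.2 p. 25, §7.1
  pp. 42–43; v2 (2026) Thm. 1.7 and end of §4.2 ("follows by [GPS13, Sec. 2.3]").
* [SchrammSmirnov2011] O. Schramm, S. Smirnov, Ann. Probab. 39 (2011), arXiv:1101.5820: §1.3
  (`ℋ_D`, `𝒯_D`), Thm. 1.4, Lemma 5.1 and eq. (5.1).
* [GPS13] C. Garban, G. Pete, O. Schramm, *Pivotal, cluster and interface measures for critical
  planar percolation*, J. Amer. Math. Soc. 26 (2013), §2.3.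
-/

noncomputable section

open Set Filter Metric
open _root_.MeasureTheory _root_.Topology
open scoped ENNReal Real
open Literature.Probability.LatticeModels Literature.Probability.RandomPlanarGeometry

namespace Literature.Probability.Percolation

open QuadCrossing

/-! ### Membership in `S^{β}_{ω}` and raw crossings inside `δ𝕃(β)` -/

/-- A raw crossing of `Q` inside the open edges drawn on `δ𝕃(β)` puts `Q` into `S^{β}_{ω}`.
[cite: SchrammSmirnov2011, §1.3] -/
theorem mem_isoRectQuadConfig_of_isCrossing {β δ : ℝ} {ω : BondConfig (Site 2)}
    {Q : Quad (univ : Set ℂ)} {K : Set ℂ} (hK : Q.IsCrossing K)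
    (hKO : K ⊆ openEdgeUnionEmb (isoRectDrawing β) δ ω) : Q ∈ isoRectQuadConfig β δ ω := by
  show Q ∈ (configOf (isoRectDrawing β) δ univ (ω ∩ (zdGraph 2).edgeSet) : Set (Quad (univ : Set ℂ)))
  rw [coe_configOf_inter_edgeSet]
  exact subset_closure ⟨K, hK, hKO⟩

/-- `P₂ ∈ S^{β}_{ω}` and `P₁ < P₂` give a raw crossing of `P₁` inside the open edges drawn on
`δ𝕃(β)`. [cite: SchrammSmirnov2011, §1.3] -/
theorem exists_isCrossing_of_mem_isoRectQuadConfig {β δ : ℝ} {ω : BondConfig (Site 2)}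
    {P₁ P₂ : Quad (univ : Set ℂ)} (hlt : P₁.StrictlyDominated P₂)
    (hmem : P₂ ∈ isoRectQuadConfig β δ ω) :
    ∃ K, P₁.IsCrossing K ∧ K ⊆ openEdgeUnionEmb (isoRectDrawing β) δ ω :=
  exists_isCrossing_of_mem_configOf _ δ hlt hmem

/-- `P₁ ∉ S^{β}_{ω}` and `P₁ < P₂` forbid a raw crossing of `P₂` inside the open edges drawn on
`δ𝕃(β)`. [cite: SchrammSmirnov2011, §1.3] -/
theorem not_exists_isCrossing_of_not_mem_isoRectQuadConfig {β δ : ℝ} {ω : BondConfig (Site 2)}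
    {P₁ P₂ : Quad (univ : Set ℂ)} (hlt : P₁.StrictlyDominated P₂)
    (hP₁ : P₁ ∉ isoRectQuadConfig β δ ω) :
    ¬ ∃ K, P₂.IsCrossing K ∧ K ⊆ openEdgeUnionEmb (isoRectDrawing β) δ ω :=
  not_exists_isCrossing_of_not_mem_configOf _ δ hlt hP₁

/-! ### Schramm–Smirnov's (5.1) on the reference lattice `δ𝕃(π/2) = e^{iπ/4}√2 δℤ²` -/

/-- **(5.1) for critical bond percolation drawn on `δ𝕃(π/2)`.** From (5.1) on `δℤ²` (the
hypothesis of `SchrammSmirnov2011_lemma_5_1_of_continuity` at `D = univ`): rotate the quad by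
`-π/4`, take `Q'₀ < e^{-iπ/4}Q₀ < Q''₀` and `δ_c` there, rotate back; raw crossings inside `δ𝕃(π/2)`
are raw crossings of the rotated quads inside `(√2 δ)ℤ²`
(`exists_isCrossing_isoRectDrawing_pi_div_two_iff`), and `√2 δ < δ_c` once `δ < δ_c / 2`.
[cite: SchrammSmirnov2011, eq. (5.1); DKKMO2020Rotational, §2.1 p. 7] -/
theorem continuity_isoRectDrawing_pi_div_two
    (hcont : ∀ (Q₀ : Quad (univ : Set ℂ)) (ε : ℝ≥0∞), 0 < ε →
      ∃ Q' Q'' : Quad (univ : Set ℂ), Quad.StrictlyDominated Q' Q₀ ∧ Quad.StrictlyDominated Q₀ Q'' ∧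
        ∃ δ₀ : ℝ, 0 < δ₀ ∧ ∀ δ : ℝ, 0 < δ → δ < δ₀ →
          bondPercolation (zdGraph 2) half
            {ω | (∃ K, Q'.IsCrossing K ∧ K ⊆ openEdgeUnion δ ω) ∧
              ¬ ∃ K, Q''.IsCrossing K ∧ K ⊆ openEdgeUnion δ ω} ≤ ε)
    (Q₀ : Quad (univ : Set ℂ)) {η : ℝ≥0∞} (hη : 0 < η) :
    ∃ Q' Q'' : Quad (univ : Set ℂ), Quad.StrictlyDominated Q' Q₀ ∧ Quad.StrictlyDominated Q₀ Q'' ∧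
      ∃ δ₁ : ℝ, 0 < δ₁ ∧ ∀ δ : ℝ, 0 < δ → δ < δ₁ →
        bondPercolation (zdGraph 2) half
          {ω | (∃ K, Q'.IsCrossing K ∧ K ⊆ openEdgeUnionEmb (isoRectDrawing (π / 2)) δ ω) ∧
            ¬ ∃ K, Q''.IsCrossing K ∧ K ⊆ openEdgeUnionEmb (isoRectDrawing (π / 2)) δ ω} ≤ η := by
  set ρ : ℂ ≃ₜ ℂ := (rotation (Circle.exp (π / 4))).toHomeomorph with hρ
  set P₀ : Quad (univ : Set ℂ) := Q₀.mapHomeomorph ρ.symm with hP₀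
  obtain ⟨Q'₀, Q''₀, hQ'P₀, hP₀Q'', δc, hδc, hE⟩ := hcont P₀ η hη
  set Q' : Quad (univ : Set ℂ) := Q'₀.mapHomeomorph ρ with hQ'
  set Q'' : Quad (univ : Set ℂ) := Q''₀.mapHomeomorph ρ with hQ''
  have hQ'Q : Quad.StrictlyDominated Q' Q₀ := by
    simpa only [hP₀, Quad.mapHomeomorph_mapHomeomorph_symm] using hQ'P₀.mapHomeomorph ρ
  have hQQ'' : Quad.StrictlyDominated Q₀ Q'' := by
    simpa only [hP₀, Quad.mapHomeomorph_mapHomeomorph_symm] using hP₀Q''.mapHomeomorph ρ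
  have hQ'symm : Q'.mapHomeomorph ρ.symm = Q'₀ := Quad.mapHomeomorph_symm_mapHomeomorph ρ Q'₀
  have hQ''symm : Q''.mapHomeomorph ρ.symm = Q''₀ := Quad.mapHomeomorph_symm_mapHomeomorph ρ Q''₀
  refine ⟨Q', Q'', hQ'Q, hQQ'', δc / 2, by positivity, fun δ hδ hδlt => ?_⟩
  have hδ' : 0 < Real.sqrt 2 * δ := by positivity
  have hδ'c : Real.sqrt 2 * δ < δc := by
    have h2 : Real.sqrt 2 < 2 := by
      rw [show (2 : ℝ) = Real.sqrt 4 by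
        rw [show (4 : ℝ) = 2 ^ 2 by norm_num, Real.sqrt_sq (by norm_num : (0:ℝ) ≤ 2)]]
      exact Real.sqrt_lt_sqrt (by norm_num) (by norm_num)
    nlinarith
  refine (measure_mono ?_).trans (hE _ hδ' hδ'c)
  rintro ω ⟨hω₁, hω₂⟩
  refine ⟨?_, fun h' => hω₂ ?_⟩
  · have := (exists_isCrossing_isoRectDrawing_pi_div_two_iff Q' δ ω).1 hω₁
    rwa [hQ'symm] at this
  · refine (exists_isCrossing_isoRectDrawing_pi_div_two_iff Q'' δ ω).2 ?_
    rwa [hQ''symm]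

/-! ### What a subbasic piece costs, the reference configuration inside the piece -/

/-- **Per-piece estimate on the reference lattice.** Given (5.1) and a piece `s` (`int ⊞_Q` or
`V^Q`) of Schramm–Smirnov's subbase, for every budget `η > 0` there are a quad `q` and events
`E_δ` of `P_{1/2}`-probability `≤ η` for small meshes such that: if `S^{π/2}_{ω'} ∈ s` and
`S ∉ s` then either `ω' ∈ E_δ` or the crossing indicators of `q` in `S` and `S^{π/2}_{ω'}` disagree.
For `V^Q`: `q = Q`, `E = ∅`. For `int ⊞_Q`: `Q' < Q < Q⁺ < Q''` from (5.1) on `δ𝕃(π/2)`, `q = Q⁺`,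
`E_δ = {Q' raw-crossed ∧ Q'' not}` (the argument of `exists_quad_event_of_piece`).
[cite: SchrammSmirnov2011, eq. (5.1); DKKMO2020Rotational, §7.1 p. 42] -/
theorem exists_quad_event_of_piece_isoRect
    (hcont : ∀ (Q₀ : Quad (univ : Set ℂ)) (ε : ℝ≥0∞), 0 < ε →
      ∃ Q' Q'' : Quad (univ : Set ℂ), Quad.StrictlyDominated Q' Q₀ ∧ Quad.StrictlyDominated Q₀ Q'' ∧
        ∃ δ₀ : ℝ, 0 < δ₀ ∧ ∀ δ : ℝ, 0 < δ → δ < δ₀ →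
          bondPercolation (zdGraph 2) half
            {ω | (∃ K, Q'.IsCrossing K ∧ K ⊆ openEdgeUnion δ ω) ∧
              ¬ ∃ K, Q''.IsCrossing K ∧ K ⊆ openEdgeUnion δ ω} ≤ ε)
    {s : Set (QuadConfig (univ : Set ℂ))}
    (hs : (∃ Q, s = interior (QuadConfig.crossedEvent Q)) ∨ ∃ Q, s = QuadConfig.notCrossed Q)
    {η : ℝ≥0∞} (hη : 0 < η) :
    ∃ (q : Quad (univ : Set ℂ)) (E : ℝ → Set (BondConfig (Site 2))) (δ₁ : ℝ), 0 < δ₁ ∧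
      (∀ δ : ℝ, 0 < δ → δ < δ₁ → bondPercolation (zdGraph 2) half (E δ) ≤ η) ∧
      ∀ (δ : ℝ) (ω' : BondConfig (Site 2)) (S : QuadConfig (univ : Set ℂ)),
        isoRectQuadConfig (π / 2) δ ω' ∈ s → S ∉ s →
          ω' ∈ E δ ∨ ¬ (q ∈ S ↔ q ∈ isoRectQuadConfig (π / 2) δ ω') := by
  rcases hs with ⟨Q, rfl⟩ | ⟨Q, rfl⟩
  · obtain ⟨Q', Q'', hQ'Q, hQQ'', δ₁, hδ₁, hE⟩ := continuity_isoRectDrawing_pi_div_two hcont Q hη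
    obtain ⟨Qp, hQQp, hQpQ''⟩ := Quad.exists_strictlyDominated_between isOpen_univ hQQ''
    refine ⟨Qp, fun δ => {ω | (∃ K, Q'.IsCrossing K ∧
        K ⊆ openEdgeUnionEmb (isoRectDrawing (π / 2)) δ ω) ∧
      ¬ ∃ K, Q''.IsCrossing K ∧ K ⊆ openEdgeUnionEmb (isoRectDrawing (π / 2)) δ ω}, δ₁, hδ₁, hE,
      fun δ ω' S hS' hS => ?_⟩
    have hQS' : isoRectQuadConfig (π / 2) δ ω' ∈ QuadConfig.crossedEvent Q := interior_subset hS'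
    have hQpS : Qp ∉ S := fun h' => hS (QuadConfig.mem_interior_crossedEvent_of_mem hQQp h')
    by_cases hq : Qp ∈ isoRectQuadConfig (π / 2) δ ω'
    · exact Or.inr fun hiff => hQpS (hiff.mpr hq)
    · exact Or.inl ⟨exists_isCrossing_of_mem_isoRectQuadConfig hQ'Q hQS',
        not_exists_isCrossing_of_not_mem_isoRectQuadConfig hQpQ'' hq⟩
  · refine ⟨Q, fun _ => ∅, 1, one_pos, fun δ _ _ => by simp, fun δ ω' S hS' hS => Or.inr ?_⟩
    have hQS : Q ∈ S := not_not.mp hS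
    exact fun hiff => hS' (hiff.mp hQS)

/-! ### The fact from couplings agreeing on finitely many quads -/

/-- **DKKMO Thm. 2.1 (`d_SS` half, `q = 1`) from couplings agreeing on finitely many quads and the
continuity estimate (5.1).** Hypotheses: `hcont` — Schramm–Smirnov's (5.1) for critical bond
percolation on `δℤ²` (literally the hypothesis of `SchrammSmirnov2011_lemma_5_1_of_continuity` at
`D = univ`); `hF` — for every `ε > 0` and every finite family `F` of quads there is `δ₀ > 0` such
that for `α ∈ (ε, π - ε)` and `0 < δ ≤ δ₀` some coupling of `φ_{δ𝕃(α)}` and `φ_{δ𝕃(π/2)}` makes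
the crossing indicators of every `Q ∈ F` in `S^{α}_{ω}` and in `S^{π/2}_{ω'}` agree outside an
event of probability `< ε`. Conclusion: `DKKMO2020_thm21_schrammSmirnov`. Proof: finitely many
pieces `int ⊞_Q`, `V^Q` detect the SWAPPED neighbourhood `{(S', S) : (S, S') ∈ N}`
(`QuadConfig.exists_finite_pieces_of_nhds_diagonal`), so that the reference configuration
`S^{π/2}_{ω'}` sits inside the detecting piece and the (5.1)-events fall on `ω'`
(`exists_quad_event_of_piece_isoRect`, budget `ε / (2(n+1))` each); a union bound under the
coupling of `hF` for the quads of the pieces at `ε / 2` concludes.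
[cite: DKKMO2020Rotational, Thm. 2.1 (d_SS part) and §7.1 p. 42] -/
theorem DKKMO2020_thm21_schrammSmirnov_of_finiteQuads_of_continuity
    (hcont : ∀ (Q₀ : Quad (univ : Set ℂ)) (ε : ℝ≥0∞), 0 < ε →
      ∃ Q' Q'' : Quad (univ : Set ℂ), Quad.StrictlyDominated Q' Q₀ ∧ Quad.StrictlyDominated Q₀ Q'' ∧
        ∃ δ₀ : ℝ, 0 < δ₀ ∧ ∀ δ : ℝ, 0 < δ → δ < δ₀ →
          bondPercolation (zdGraph 2) half
            {ω | (∃ K, Q'.IsCrossing K ∧ K ⊆ openEdgeUnion δ ω) ∧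
              ¬ ∃ K, Q''.IsCrossing K ∧ K ⊆ openEdgeUnion δ ω} ≤ ε)
    (hF : ∀ ε : ℝ, 0 < ε → ∀ F : Finset (Quad (univ : Set ℂ)),
      ∃ δ₀ : ℝ, 0 < δ₀ ∧ ∀ α ∈ Set.Ioo ε (π - ε), ∀ δ : ℝ, 0 < δ → δ ≤ δ₀ →
        ∃ P : Measure (BondConfig (Site 2) × BondConfig (Site 2)),
          P.map Prod.fst = prodBernoulli (isoRectCriticalProb α) ∧
          P.map Prod.snd = prodBernoulli (isoRectCriticalProb (π / 2)) ∧
          P {p | ∃ Q ∈ F, ¬ (Q ∈ isoRectQuadConfig α δ p.1 ↔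
            Q ∈ isoRectQuadConfig (π / 2) δ p.2)} < ENNReal.ofReal ε) :
    DKKMO2020_thm21_schrammSmirnov := by
  classical
  intro ε hε N hN hdiag
  -- the swapped neighbourhood: the reference configuration goes first
  set N' : Set (QuadConfig (univ : Set ℂ) × QuadConfig (univ : Set ℂ)) := {p | (p.2, p.1) ∈ N}
    with hN'def
  have hN' : IsOpen N' := hN.preimage continuous_swap
  have hdiag' : ∀ S, (S, S) ∈ N' := fun S => hdiag S
  obtain ⟨𝔉, h𝔉, hpieces, hdetect⟩ := QuadConfig.exists_finite_pieces_of_nhds_diagonal hN' hdiag'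
  -- the budget of each piece
  set n : ℕ := h𝔉.toFinset.card with hn
  have hηpos : 0 < ε / (2 * (n + 1)) := by positivity
  have hη0 : 0 < ENNReal.ofReal (ε / (2 * (n + 1))) := ENNReal.ofReal_pos.2 hηpos
  -- per-piece data: a quad, a family of small events of the reference configuration, a mesh bound
  have key : ∀ s ∈ 𝔉, ∃ (q : Quad (univ : Set ℂ)) (E : ℝ → Set (BondConfig (Site 2))) (δ₁ : ℝ),
      0 < δ₁ ∧
      (∀ δ : ℝ, 0 < δ → δ < δ₁ →
        bondPercolation (zdGraph 2) half (E δ) ≤ ENNReal.ofReal (ε / (2 * (n + 1)))) ∧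
      ∀ (δ : ℝ) (ω' : BondConfig (Site 2)) (S : QuadConfig (univ : Set ℂ)),
        isoRectQuadConfig (π / 2) δ ω' ∈ s → S ∉ s →
          ω' ∈ E δ ∨ ¬ (q ∈ S ↔ q ∈ isoRectQuadConfig (π / 2) δ ω') :=
    fun s hs => exists_quad_event_of_piece_isoRect hcont (hpieces s hs) hη0
  haveI : Nonempty (Quad (univ : Set ℂ)) := ⟨Quad.unitSquare⟩
  choose! q E δ₁ hδ₁ hEle hcase using key
  obtain ⟨δ₂, hδ₂, hδ₂le⟩ := exists_pos_le_of_finite h𝔉 hδ₁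
  -- the finite family of quads and the coupling, at `ε / 2`
  set F : Finset (Quad (univ : Set ℂ)) := h𝔉.toFinset.image q with hFdef
  have hε2 : 0 < ε / 2 := by positivity
  obtain ⟨δF, hδF, hcoup⟩ := hF (ε / 2) hε2 F
  refine ⟨min δF (δ₂ / 2), lt_min hδF (by positivity), fun α hα δ hδ hδle => ?_⟩
  have hα' : α ∈ Set.Ioo (ε / 2) (π - ε / 2) := ⟨by linarith [hα.1], by linarith [hα.2]⟩
  obtain ⟨P, hP1, hP2, hPF⟩ := hcoup α hα' δ hδ (hδle.trans (min_le_left _ _))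
  refine ⟨P, hP1, hP2, ?_⟩
  have hδ₁lt : ∀ s ∈ 𝔉, δ < δ₁ s := fun s hs =>
    (hδle.trans (min_le_right _ _)).trans_lt ((half_lt_self hδ₂).trans_le (hδ₂le s hs))
  -- the inclusion of events
  have hincl : {p : BondConfig (Site 2) × BondConfig (Site 2) |
      (isoRectQuadConfig α δ p.1, isoRectQuadConfig (π / 2) δ p.2) ∉ N} ⊆
      (⋃ s ∈ h𝔉.toFinset, Prod.snd ⁻¹' E s δ) ∪
        {p | ∃ Q ∈ F, ¬ (Q ∈ isoRectQuadConfig α δ p.1 ↔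
          Q ∈ isoRectQuadConfig (π / 2) δ p.2)} := by
    rintro ⟨ω, ω'⟩ hp
    obtain ⟨s, hs, hS', hS⟩ := hdetect (isoRectQuadConfig (π / 2) δ ω') (isoRectQuadConfig α δ ω) hp
    rcases hcase s hs δ ω' _ hS' hS with hEω | hdis
    · exact Or.inl (mem_iUnion₂.2 ⟨s, h𝔉.mem_toFinset.2 hs, hEω⟩)
    · exact Or.inr ⟨q s, Finset.mem_image_of_mem q (h𝔉.mem_toFinset.2 hs), hdis⟩
  -- measure bounds
  have hsum : P (⋃ s ∈ h𝔉.toFinset, Prod.snd ⁻¹' E s δ) ≤ ENNReal.ofReal (ε / 2) := by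
    calc P (⋃ s ∈ h𝔉.toFinset, Prod.snd ⁻¹' E s δ)
        ≤ ∑ s ∈ h𝔉.toFinset, P (Prod.snd ⁻¹' E s δ) := measure_biUnion_finset_le _ _
      _ ≤ ∑ s ∈ h𝔉.toFinset, ENNReal.ofReal (ε / (2 * (n + 1))) :=
          Finset.sum_le_sum fun s hs => ?_
      _ = n * ENNReal.ofReal (ε / (2 * (n + 1))) := by rw [Finset.sum_const, nsmul_eq_mul]
      _ ≤ ENNReal.ofReal (ε / 2) := natCast_mul_ofReal_div_le n hε.le
    calc P (Prod.snd ⁻¹' E s δ) ≤ P.map Prod.snd (E s δ) :=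
          Measure.le_map_apply measurable_snd.aemeasurable _
      _ = bondPercolation (zdGraph 2) half (E s δ) := by
          rw [hP2, prodBernoulli_isoRectCriticalProb_pi_div_two]
      _ ≤ ENNReal.ofReal (ε / (2 * (n + 1))) :=
          hEle s (h𝔉.mem_toFinset.1 hs) δ hδ (hδ₁lt s (h𝔉.mem_toFinset.1 hs))
  calc P {p | (isoRectQuadConfig α δ p.1, isoRectQuadConfig (π / 2) δ p.2) ∉ N}
      ≤ P ((⋃ s ∈ h𝔉.toFinset, Prod.snd ⁻¹' E s δ) ∪
          {p | ∃ Q ∈ F, ¬ (Q ∈ isoRectQuadConfig α δ p.1 ↔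
            Q ∈ isoRectQuadConfig (π / 2) δ p.2)}) := measure_mono hincl
    _ ≤ P (⋃ s ∈ h𝔉.toFinset, Prod.snd ⁻¹' E s δ) +
          P {p | ∃ Q ∈ F, ¬ (Q ∈ isoRectQuadConfig α δ p.1 ↔
            Q ∈ isoRectQuadConfig (π / 2) δ p.2)} := measure_union_le _ _
    _ < ENNReal.ofReal (ε / 2) + ENNReal.ofReal (ε / 2) :=
        ENNReal.add_lt_add_of_le_of_lt (ne_top_of_le_ne_top ENNReal.ofReal_ne_top hsum) hsum hPF
    _ = ENNReal.ofReal ε := by rw [← ENNReal.ofReal_add hε2.le hε2.le, add_halves]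

/-- **Conversely, the fact and (5.1) give couplings agreeing on finitely many quads.** For `Q ∈ F`
take `Q' < Q_m < Q < Q_p < Q''` from (5.1) on `δ𝕃(π/2)` at `Q` and the open neighbourhood of the
diagonal `N = ⋂_{Q ∈ F} {Q_p ∈ S' → S ∈ int ⊞_Q} ∩ {Q ∈ S → S' ∈ int ⊞_{Q_m}}` (`S` the `𝕃(α)`
coordinate, `S'` the reference one); under the coupling of the fact at `(ε/2, N)`, a disagreement at
`Q` on `N` forces `Q ∈ S' ∌ Q_p` or `Q_m ∈ S' ∌ Q`, hence the (5.1)-event `{Q' raw-crossed ∧ Q'' not}`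
of the reference configuration. [cite: DKKMO2020Rotational, Thm. 2.1 (d_SS part) and §7.1 p. 42] -/
theorem finiteQuads_of_DKKMO2020_thm21_schrammSmirnov_of_continuity
    (h : DKKMO2020_thm21_schrammSmirnov)
    (hcont : ∀ (Q₀ : Quad (univ : Set ℂ)) (ε : ℝ≥0∞), 0 < ε →
      ∃ Q' Q'' : Quad (univ : Set ℂ), Quad.StrictlyDominated Q' Q₀ ∧ Quad.StrictlyDominated Q₀ Q'' ∧
        ∃ δ₀ : ℝ, 0 < δ₀ ∧ ∀ δ : ℝ, 0 < δ → δ < δ₀ →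
          bondPercolation (zdGraph 2) half
            {ω | (∃ K, Q'.IsCrossing K ∧ K ⊆ openEdgeUnion δ ω) ∧
              ¬ ∃ K, Q''.IsCrossing K ∧ K ⊆ openEdgeUnion δ ω} ≤ ε) :
    ∀ ε : ℝ, 0 < ε → ∀ F : Finset (Quad (univ : Set ℂ)),
      ∃ δ₀ : ℝ, 0 < δ₀ ∧ ∀ α ∈ Set.Ioo ε (π - ε), ∀ δ : ℝ, 0 < δ → δ ≤ δ₀ →
        ∃ P : Measure (BondConfig (Site 2) × BondConfig (Site 2)),
          P.map Prod.fst = prodBernoulli (isoRectCriticalProb α) ∧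
          P.map Prod.snd = prodBernoulli (isoRectCriticalProb (π / 2)) ∧
          P {p | ∃ Q ∈ F, ¬ (Q ∈ isoRectQuadConfig α δ p.1 ↔
            Q ∈ isoRectQuadConfig (π / 2) δ p.2)} < ENNReal.ofReal ε := by
  classical
  intro ε hε F
  set n : ℕ := F.card with hn
  have hηpos : 0 < ε / (2 * (n + 1)) := by positivity
  have hη0 : 0 < ENNReal.ofReal (ε / (2 * (n + 1))) := ENNReal.ofReal_pos.2 hηpos
  -- per quad: the data of (5.1) on `δ𝕃(π/2)` and intermediate quads `Q' < Qm < Q < Qp < Q''`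
  have key : ∀ Q : Quad (univ : Set ℂ), ∃ (Qm Qp Q' Q'' : Quad (univ : Set ℂ)) (δ₁ : ℝ),
      Quad.StrictlyDominated Q' Qm ∧ Quad.StrictlyDominated Qm Q ∧ Quad.StrictlyDominated Q Qp ∧
      Quad.StrictlyDominated Qp Q'' ∧ 0 < δ₁ ∧ ∀ δ : ℝ, 0 < δ → δ < δ₁ →
        bondPercolation (zdGraph 2) half
          {ω | (∃ K, Q'.IsCrossing K ∧ K ⊆ openEdgeUnionEmb (isoRectDrawing (π / 2)) δ ω) ∧
            ¬ ∃ K, Q''.IsCrossing K ∧ K ⊆ openEdgeUnionEmb (isoRectDrawing (π / 2)) δ ω} ≤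
          ENNReal.ofReal (ε / (2 * (n + 1))) := by
    intro Q
    obtain ⟨Q', Q'', hQ'Q, hQQ'', δ₁, hδ₁, hE⟩ := continuity_isoRectDrawing_pi_div_two hcont Q hη0
    obtain ⟨Qm, hQ'Qm, hQmQ⟩ := Quad.exists_strictlyDominated_between isOpen_univ hQ'Q
    obtain ⟨Qp, hQQp, hQpQ''⟩ := Quad.exists_strictlyDominated_between isOpen_univ hQQ''
    exact ⟨Qm, Qp, Q', Q'', δ₁, hQ'Qm, hQmQ, hQQp, hQpQ'', hδ₁, hE⟩
  choose Qm Qp Q' Q'' δ₁ hQ'Qm hQmQ hQQp hQpQ'' hδ₁ hE using key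
  -- the open neighbourhood of the diagonal (`p.1` on `δ𝕃(α)`, `p.2` the reference configuration)
  set N : Set (QuadConfig (univ : Set ℂ) × QuadConfig (univ : Set ℂ)) :=
    ⋂ Q ∈ F, ({p | Qp Q ∈ p.2 → p.1 ∈ interior (QuadConfig.crossedEvent Q)} ∩
      {p | Q ∈ p.1 → p.2 ∈ interior (QuadConfig.crossedEvent (Qm Q))}) with hNdef
  have hNopen : IsOpen N := by
    refine isOpen_biInter_finset fun Q _ => IsOpen.inter ?_ ?_
    · have : {p : QuadConfig (univ : Set ℂ) × QuadConfig (univ : Set ℂ) |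
          Qp Q ∈ p.2 → p.1 ∈ interior (QuadConfig.crossedEvent Q)} =
          ((interior (QuadConfig.crossedEvent Q))ᶜ ×ˢ QuadConfig.crossedEvent (Qp Q))ᶜ := by
        ext p
        simp only [mem_setOf_eq, mem_compl_iff, mem_prod, QuadConfig.mem_crossedEvent]
        tauto
      rw [this]
      exact (isOpen_interior.isClosed_compl.prod (QuadConfig.isClosed_crossedEvent _)).isOpen_compl
    · have : {p : QuadConfig (univ : Set ℂ) × QuadConfig (univ : Set ℂ) |
          Q ∈ p.1 → p.2 ∈ interior (QuadConfig.crossedEvent (Qm Q))} =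
          (QuadConfig.crossedEvent Q ×ˢ (interior (QuadConfig.crossedEvent (Qm Q)))ᶜ)ᶜ := by
        ext p
        simp only [mem_setOf_eq, mem_compl_iff, mem_prod, QuadConfig.mem_crossedEvent]
        tauto
      rw [this]
      exact ((QuadConfig.isClosed_crossedEvent _).prod isOpen_interior.isClosed_compl).isOpen_compl
  have hNdiag : ∀ S, (S, S) ∈ N := fun S => mem_iInter₂.2 fun Q _ =>
    ⟨fun hS => QuadConfig.mem_interior_crossedEvent_of_mem (hQQp Q) hS,
      fun hS => QuadConfig.mem_interior_crossedEvent_of_mem (hQmQ Q) hS⟩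
  -- a common mesh bound and the coupling of the fact at `ε / 2`
  obtain ⟨δ₂, hδ₂, hδ₂le⟩ := exists_pos_le_of_finite F.finite_toSet fun Q _ => hδ₁ Q
  have hε2 : 0 < ε / 2 := by positivity
  obtain ⟨δh, hδh, hcoup⟩ := h (ε / 2) hε2 N hNopen hNdiag
  refine ⟨min δh (δ₂ / 2), lt_min hδh (by positivity), fun α hα δ hδ hδle => ?_⟩
  have hα' : α ∈ Set.Ioo (ε / 2) (π - ε / 2) := ⟨by linarith [hα.1], by linarith [hα.2]⟩
  obtain ⟨P, hP1, hP2, hPN⟩ := hcoup α hα' δ hδ (hδle.trans (min_le_left _ _))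
  refine ⟨P, hP1, hP2, ?_⟩
  have hδ₁lt : ∀ Q ∈ F, δ < δ₁ Q := fun Q hQ =>
    (hδle.trans (min_le_right _ _)).trans_lt ((half_lt_self hδ₂).trans_le (hδ₂le Q hQ))
  -- the (5.1)-events of the quads of `F` at mesh `δ`, for the reference configuration
  set E : Quad (univ : Set ℂ) → Set (BondConfig (Site 2)) := fun Q =>
    {ω | (∃ K, (Q' Q).IsCrossing K ∧ K ⊆ openEdgeUnionEmb (isoRectDrawing (π / 2)) δ ω) ∧
      ¬ ∃ K, (Q'' Q).IsCrossing K ∧ K ⊆ openEdgeUnionEmb (isoRectDrawing (π / 2)) δ ω} with hEdef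
  -- the inclusion of events
  have hincl : {p : BondConfig (Site 2) × BondConfig (Site 2) | ∃ Q ∈ F,
      ¬ (Q ∈ isoRectQuadConfig α δ p.1 ↔ Q ∈ isoRectQuadConfig (π / 2) δ p.2)} ⊆
      {p | (isoRectQuadConfig α δ p.1, isoRectQuadConfig (π / 2) δ p.2) ∉ N} ∪
        ⋃ Q ∈ F, Prod.snd ⁻¹' E Q := by
    rintro ⟨ω, ω'⟩ ⟨Q, hQF, hdis⟩
    by_cases hpN : (isoRectQuadConfig α δ ω, isoRectQuadConfig (π / 2) δ ω') ∈ N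
    · refine Or.inr (mem_iUnion₂.2 ⟨Q, hQF, ?_⟩)
      have hQN := mem_iInter₂.1 hpN Q hQF
      show ω' ∈ E Q
      by_cases hQS' : Q ∈ isoRectQuadConfig (π / 2) δ ω'
      · -- `Q ∈ S'`, so `Q ∉ S`, and on `N`, `Qp ∉ S'`
        have hQS : Q ∉ isoRectQuadConfig α δ ω := fun h' => hdis ⟨fun _ => hQS', fun _ => h'⟩
        have hQp : Qp Q ∉ isoRectQuadConfig (π / 2) δ ω' := fun h' =>
          hQS (show isoRectQuadConfig α δ ω ∈ QuadConfig.crossedEvent Q from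
            interior_subset (hQN.1 h'))
        exact ⟨exists_isCrossing_of_mem_isoRectQuadConfig ((hQ'Qm Q).trans (hQmQ Q)) hQS',
          not_exists_isCrossing_of_not_mem_isoRectQuadConfig (hQpQ'' Q) hQp⟩
      · -- `Q ∉ S'`, so `Q ∈ S`, and on `N`, `Qm ∈ S'`
        have hQS : Q ∈ isoRectQuadConfig α δ ω := by
          by_contra h'
          exact hdis ⟨fun h₁ => absurd h₁ h', fun h₂ => absurd h₂ hQS'⟩
        have hQm : isoRectQuadConfig (π / 2) δ ω' ∈ QuadConfig.crossedEvent (Qm Q) :=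
          interior_subset (hQN.2 hQS)
        exact ⟨exists_isCrossing_of_mem_isoRectQuadConfig (hQ'Qm Q) hQm,
          not_exists_isCrossing_of_not_mem_isoRectQuadConfig ((hQQp Q).trans (hQpQ'' Q)) hQS'⟩
    · exact Or.inl hpN
  -- measure bounds
  have hsum : P (⋃ Q ∈ F, Prod.snd ⁻¹' E Q) ≤ ENNReal.ofReal (ε / 2) := by
    calc P (⋃ Q ∈ F, Prod.snd ⁻¹' E Q)
        ≤ ∑ Q ∈ F, P (Prod.snd ⁻¹' E Q) := measure_biUnion_finset_le _ _
      _ ≤ ∑ Q ∈ F, ENNReal.ofReal (ε / (2 * (n + 1))) := Finset.sum_le_sum fun Q hQ => ?_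
      _ = n * ENNReal.ofReal (ε / (2 * (n + 1))) := by rw [Finset.sum_const, nsmul_eq_mul]
      _ ≤ ENNReal.ofReal (ε / 2) := natCast_mul_ofReal_div_le n hε.le
    calc P (Prod.snd ⁻¹' E Q) ≤ P.map Prod.snd (E Q) :=
          Measure.le_map_apply measurable_snd.aemeasurable _
      _ = bondPercolation (zdGraph 2) half (E Q) := by
          rw [hP2, prodBernoulli_isoRectCriticalProb_pi_div_two]
      _ ≤ ENNReal.ofReal (ε / (2 * (n + 1))) := hE Q δ hδ (hδ₁lt Q hQ)
  calc P {p | ∃ Q ∈ F, ¬ (Q ∈ isoRectQuadConfig α δ p.1 ↔ Q ∈ isoRectQuadConfig (π / 2) δ p.2)}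
      ≤ P ({p | (isoRectQuadConfig α δ p.1, isoRectQuadConfig (π / 2) δ p.2) ∉ N} ∪
          ⋃ Q ∈ F, Prod.snd ⁻¹' E Q) := measure_mono hincl
    _ ≤ P {p | (isoRectQuadConfig α δ p.1, isoRectQuadConfig (π / 2) δ p.2) ∉ N} +
          P (⋃ Q ∈ F, Prod.snd ⁻¹' E Q) := measure_union_le _ _
    _ < ENNReal.ofReal (ε / 2) + ENNReal.ofReal (ε / 2) :=
        ENNReal.add_lt_add_of_lt_of_le (ne_top_of_le_ne_top ENNReal.ofReal_ne_top hsum) hPN hsum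
    _ = ENNReal.ofReal ε := by rw [← ENNReal.ofReal_add hε2.le hε2.le, add_halves]

/-- **DKKMO's `d_SS` statement among the rectangular lattices is EQUIVALENT to the statement about
finitely many quads**: for every finite family of quads and `ε > 0`, for `α ∈ (ε, π - ε)` and small
meshes, some coupling of `φ_{δ𝕃(α)}` and `φ_{δ𝕃(π/2)}` makes all the crossing indicators of the
family in `S^{α}_{ω}` and `S^{π/2}_{ω'}` agree outside an event of probability `< ε`
(Schramm–Smirnov's Lemma 5.1 being discharged in the tree, `SchrammSmirnov2011_lemma_5_1_holds`).
[cite: DKKMO2020Rotational, Thm. 2.1 (d_SS part) and §7.1 p. 42] -/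
theorem DKKMO2020_thm21_schrammSmirnov_iff_finiteQuads :
    DKKMO2020_thm21_schrammSmirnov ↔
      ∀ ε : ℝ, 0 < ε → ∀ F : Finset (Quad (univ : Set ℂ)),
        ∃ δ₀ : ℝ, 0 < δ₀ ∧ ∀ α ∈ Set.Ioo ε (π - ε), ∀ δ : ℝ, 0 < δ → δ ≤ δ₀ →
          ∃ P : Measure (BondConfig (Site 2) × BondConfig (Site 2)),
            P.map Prod.fst = prodBernoulli (isoRectCriticalProb α) ∧
            P.map Prod.snd = prodBernoulli (isoRectCriticalProb (π / 2)) ∧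
            P {p | ∃ Q ∈ F, ¬ (Q ∈ isoRectQuadConfig α δ p.1 ↔
              Q ∈ isoRectQuadConfig (π / 2) δ p.2)} < ENNReal.ofReal ε :=
  ⟨fun h => finiteQuads_of_DKKMO2020_thm21_schrammSmirnov_of_continuity h
      fun Q₀ ε hε => Quad.continuity_of_lemma_5_1 SchrammSmirnov2011_lemma_5_1_holds Q₀ ε hε,
    fun hF => DKKMO2020_thm21_schrammSmirnov_of_finiteQuads_of_continuity
      (fun Q₀ ε hε => Quad.continuity_of_lemma_5_1 SchrammSmirnov2011_lemma_5_1_holds Q₀ ε hε) hF⟩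

/-! ### Finitely many quads from the printed Theorem 1.7 and the per-quad transfer -/

/-- **What one quad costs under a loops-to-crossings transfer.** Given (5.1) and the per-quad
transfer hypothesis `H` of `DKKMO2020_thm21_quadCrossingProb_of_transfer`, for a quad `Q` and
budgets `η₅ > 0`, `ε' > 0` there are a closeness level `η > 0`, a mesh bound `δ_Q > 0` and
(5.1)-events `E_δ` of the reference configuration (`P_{1/2}`-probability `≤ η₅` for `δ < δ_Q`)
such that for all `α ∈ (0, π)`, `δ ∈ (0, δ_Q)` there is a further event `Bad` of the reference
configuration, of `φ_{𝕃(π/2)}`-probability `≤ 2ε'`, with: whenever the typed loop ensembles of `ω`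
on `δ𝕃(α)` and of `ω'` on `δ𝕃(π/2)` are `η`-close and the crossing indicators of `Q` in `S^{α}_{ω}`
and `S^{π/2}_{ω'}` disagree, `ω' ∈ E_δ ∪ Bad`. Construction: `Q' < Q_a < Q < Q_b < Q_c < Q''` with
`(Q', Q'')` from (5.1) on `δ𝕃(π/2)` at `Q`; conformal rectangles `R_a`, `R_b` modelling `Q_a`, `Q_b`
(`Quad.exists_conformalRectangle`); `H` at `R_a`, `R_b` with budget `ε'`;
`Bad = (𝒞(R_b) ∖ G_b) ∪ (𝒞(R_a)ᶜ ∖ B_a)`. If `Q ∈ S' ∌ ... ∉ S`: either `Q_c ∈ S'`, then `ω'`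
path-crosses `R_b` (`setOf_mem_configOf_isoRectDrawing_subset_quadCrossingEmb`) and, unless
`ω' ∈ 𝒞(R_b) ∖ G_b`, the transfer makes `ω` cross `R_b`, so `Q_b ∈ S` and `Q ∈ S` — excluded; or
`Q_c ∉ S' ∋ Q`, the (5.1)-event. If `Q ∈ S ∌ ... ∉ S'`: `ω` path-crosses `R_a`; either `ω'`
path-crosses `R_a`, then `Q_a ∈ S' ∌ Q`, the (5.1)-event; or it does not and, unless
`ω' ∈ 𝒞(R_a)ᶜ ∖ B_a`, the transfer forbids the crossing of `R_a` by `ω` — excluded.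
[cite: DKKMO2020Rotational, Thm. 2.1 (q = 1), §5.2 p. 25 and §7.1 pp. 42–43] -/
theorem exists_events_of_transfer_quad
    (hcont : ∀ (Q₀ : Quad (univ : Set ℂ)) (ε : ℝ≥0∞), 0 < ε →
      ∃ Q' Q'' : Quad (univ : Set ℂ), Quad.StrictlyDominated Q' Q₀ ∧ Quad.StrictlyDominated Q₀ Q'' ∧
        ∃ δ₀ : ℝ, 0 < δ₀ ∧ ∀ δ : ℝ, 0 < δ → δ < δ₀ →
          bondPercolation (zdGraph 2) half
            {ω | (∃ K, Q'.IsCrossing K ∧ K ⊆ openEdgeUnion δ ω) ∧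
              ¬ ∃ K, Q''.IsCrossing K ∧ K ⊆ openEdgeUnion δ ω} ≤ ε)
    (H : ∀ (R : ConformalRectangle) (ε : ℝ), 0 < ε → ∃ η : ℝ, 0 < η ∧ ∃ δ₁ : ℝ, 0 < δ₁ ∧
      ∀ α ∈ Set.Ioo (0 : ℝ) π, ∀ δ ∈ Set.Ioo (0 : ℝ) δ₁, ∃ G B : Set (BondConfig (Site 2)),
        (isoRectPercolation (π / 2)).real (quadCrossingEmb (isoRectDrawing (π / 2)) R δ \ G) ≤ ε ∧
        (isoRectPercolation (π / 2)).real
            ((quadCrossingEmb (isoRectDrawing (π / 2)) R δ)ᶜ \ B) ≤ ε ∧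
        (∀ ω ω' : BondConfig (Site 2), ω' ∈ quadCrossingEmb (isoRectDrawing (π / 2)) R δ →
          ω' ∈ G →
          LoopConfig.IsClose η (isoRectLoopConfig δ α ω) (isoRectLoopConfig δ (π / 2) ω') →
          ω ∈ quadCrossingEmb (isoRectDrawing α) R δ) ∧
        (∀ ω ω' : BondConfig (Site 2), ω' ∉ quadCrossingEmb (isoRectDrawing (π / 2)) R δ →
          ω' ∈ B →
          LoopConfig.IsClose η (isoRectLoopConfig δ α ω) (isoRectLoopConfig δ (π / 2) ω') →
          ω ∉ quadCrossingEmb (isoRectDrawing α) R δ))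
    (Q : Quad (univ : Set ℂ)) {η₅ : ℝ≥0∞} (hη₅ : 0 < η₅) {ε' : ℝ} (hε' : 0 < ε') :
    ∃ (η δQ : ℝ) (E : ℝ → Set (BondConfig (Site 2))), 0 < η ∧ 0 < δQ ∧
      (∀ δ : ℝ, 0 < δ → δ < δQ → bondPercolation (zdGraph 2) half (E δ) ≤ η₅) ∧
      ∀ α ∈ Set.Ioo (0 : ℝ) π, ∀ δ ∈ Set.Ioo (0 : ℝ) δQ, ∃ Bad : Set (BondConfig (Site 2)),
        (isoRectPercolation (π / 2)).real Bad ≤ 2 * ε' ∧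
        ∀ ω ω' : BondConfig (Site 2),
          LoopConfig.IsClose η (isoRectLoopConfig δ α ω) (isoRectLoopConfig δ (π / 2) ω') →
          ¬ (Q ∈ isoRectQuadConfig α δ ω ↔ Q ∈ isoRectQuadConfig (π / 2) δ ω') →
          ω' ∈ E δ ∨ ω' ∈ Bad := by
  -- (5.1) on the reference lattice at `Q`, and the auxiliary quads `Q' < Qa < Q < Qb < Qc < Q''`
  obtain ⟨Q', Q'', hQ'Q, hQQ'', δ₁, hδ₁, hE⟩ := continuity_isoRectDrawing_pi_div_two hcont Q hη₅
  obtain ⟨Qa, hQ'Qa, hQaQ⟩ := Quad.exists_strictlyDominated_between isOpen_univ hQ'Q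
  obtain ⟨Qb, hQQb, hQbQ''⟩ := Quad.exists_strictlyDominated_between isOpen_univ hQQ''
  obtain ⟨Qc, hQbQc, hQcQ''⟩ := Quad.exists_strictlyDominated_between isOpen_univ hQbQ''
  -- conformal rectangles modelling `Qa`, `Qb`, and the transfer data there
  obtain ⟨Ra, hca, h0a, h2a⟩ := Qa.exists_conformalRectangle
  obtain ⟨Rb, hcb, h0b, h2b⟩ := Qb.exists_conformalRectangle
  obtain ⟨ηa, hηa, δa, hδa, hHa⟩ := H Ra ε' hε'
  obtain ⟨ηb, hηb, δb, hδb, hHb⟩ := H Rb ε' hε'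
  refine ⟨min ηa ηb, min δ₁ (min δa δb),
    fun δ => {ω | (∃ K, Q'.IsCrossing K ∧ K ⊆ openEdgeUnionEmb (isoRectDrawing (π / 2)) δ ω) ∧
      ¬ ∃ K, Q''.IsCrossing K ∧ K ⊆ openEdgeUnionEmb (isoRectDrawing (π / 2)) δ ω},
    lt_min hηa hηb, lt_min hδ₁ (lt_min hδa hδb),
    fun δ hδ hδlt => hE δ hδ (hδlt.trans_le (min_le_left _ _)), fun α hα δ hδ => ?_⟩
  have hπ2 : π / 2 ∈ Set.Ioo 0 π := ⟨by positivity, by linarith [Real.pi_pos]⟩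
  have hδa' : δ ∈ Set.Ioo 0 δa := ⟨hδ.1, hδ.2.trans_le ((min_le_right _ _).trans (min_le_left _ _))⟩
  have hδb' : δ ∈ Set.Ioo 0 δb :=
    ⟨hδ.1, hδ.2.trans_le ((min_le_right _ _).trans (min_le_right _ _))⟩
  obtain ⟨Ga, Ba, -, hBa, -, htra⟩ := hHa α hα δ hδa'
  obtain ⟨Gb, Bb, hGb, -, htrb, -⟩ := hHb α hα δ hδb'
  refine ⟨(quadCrossingEmb (isoRectDrawing (π / 2)) Rb δ \ Gb) ∪
      ((quadCrossingEmb (isoRectDrawing (π / 2)) Ra δ)ᶜ \ Ba), ?_, fun ω ω' hclose hdis => ?_⟩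
  · calc (isoRectPercolation (π / 2)).real ((quadCrossingEmb (isoRectDrawing (π / 2)) Rb δ \ Gb) ∪
          ((quadCrossingEmb (isoRectDrawing (π / 2)) Ra δ)ᶜ \ Ba))
        ≤ (isoRectPercolation (π / 2)).real (quadCrossingEmb (isoRectDrawing (π / 2)) Rb δ \ Gb) +
          (isoRectPercolation (π / 2)).real ((quadCrossingEmb (isoRectDrawing (π / 2)) Ra δ)ᶜ \ Ba) :=
          measureReal_union_le _ _
      _ ≤ ε' + ε' := add_le_add hGb hBa
      _ = 2 * ε' := by ring
  have hclosea : LoopConfig.IsClose ηa (isoRectLoopConfig δ α ω) (isoRectLoopConfig δ (π / 2) ω') :=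
    hclose.mono (lt_min hηa hηb) (min_le_left _ _)
  have hcloseb : LoopConfig.IsClose ηb (isoRectLoopConfig δ α ω) (isoRectLoopConfig δ (π / 2) ω') :=
    hclose.mono (lt_min hηa hηb) (min_le_right _ _)
  by_cases hQS' : Q ∈ isoRectQuadConfig (π / 2) δ ω'
  · -- `Q ∈ S'`, `Q ∉ S`
    have hQS : Q ∉ isoRectQuadConfig α δ ω := fun h' => hdis ⟨fun _ => hQS', fun _ => h'⟩
    by_cases hQc : Qc ∈ isoRectQuadConfig (π / 2) δ ω'
    · -- `ω'` path-crosses `R_b`; unless `ω' ∉ G_b`, so does `ω`, and then `Q < Q_b ∈ S`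
      have hcross' : ω' ∈ quadCrossingEmb (isoRectDrawing (π / 2)) Rb δ :=
        setOf_mem_configOf_isoRectDrawing_subset_quadCrossingEmb hπ2 hcb.symm h0b.symm h2b.symm
          hQbQc hδ.1 hQc
      refine Or.inr (Or.inl ⟨hcross', fun hG => hQS ?_⟩)
      have hcross : ω ∈ quadCrossingEmb (isoRectDrawing α) Rb δ := htrb ω ω' hcross' hG hcloseb
      have hQb : Qb ∈ isoRectQuadConfig α δ ω :=
        quadCrossingEmb_subset_setOf_mem_configOf _ hcb.symm h0b.symm h2b.symm δ hcross
      exact (isoRectQuadConfig α δ ω).isLowerQuadSet hQb hQQb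
    · -- `Q ∈ S' ∌ Q_c`: the (5.1)-event of the reference configuration
      exact Or.inl ⟨exists_isCrossing_of_mem_isoRectQuadConfig hQ'Q hQS',
        not_exists_isCrossing_of_not_mem_isoRectQuadConfig hQcQ'' hQc⟩
  · -- `Q ∉ S'`, `Q ∈ S`: `ω` path-crosses `R_a`
    have hQS : Q ∈ isoRectQuadConfig α δ ω := by
      by_contra h'
      exact hdis ⟨fun h₁ => absurd h₁ h', fun h₂ => absurd h₂ hQS'⟩
    have hcross : ω ∈ quadCrossingEmb (isoRectDrawing α) Ra δ :=
      setOf_mem_configOf_isoRectDrawing_subset_quadCrossingEmb hα hca.symm h0a.symm h2a.symm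
        hQaQ hδ.1 hQS
    by_cases hcross' : ω' ∈ quadCrossingEmb (isoRectDrawing (π / 2)) Ra δ
    · -- `Q_a ∈ S' ∌ Q`: the (5.1)-event of the reference configuration
      have hQa : Qa ∈ isoRectQuadConfig (π / 2) δ ω' :=
        quadCrossingEmb_subset_setOf_mem_configOf _ hca.symm h0a.symm h2a.symm δ hcross'
      exact Or.inl ⟨exists_isCrossing_of_mem_isoRectQuadConfig hQ'Qa hQa,
        not_exists_isCrossing_of_not_mem_isoRectQuadConfig hQQ'' hQS'⟩
    · -- unless `ω' ∉ B_a`, the transfer forbids the crossing of `R_a` by `ω`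
      exact Or.inr (Or.inr ⟨hcross', fun hB => htra ω ω' hcross' hB hclosea hcross⟩)

/-- **Couplings agreeing on finitely many quads from the printed Theorem 1.7 and the per-quad
transfer.** Under the coupling of `dkkmo_theorem_1_7` (`ℙ[¬ d_CN-close at level C δ^c] < C δ^c`,
uniformly in `α ∈ (0, π)`), for a finite family `F` (`n` quads) the disagreement event is contained
in `{¬ close} ∪ ⋃_{Q ∈ F} {ω' ∈ E_Q ∪ Bad_Q}` (`exists_events_of_transfer_quad` with budgets
`ε/(4(n+1))` for (5.1) and `ε/(8(n+1))` for the transfer, closeness `C δ^c ≤ min_Q η_Q`), of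
probability `< C δ^c + ε/2 < ε` for `C δ^c < ε/4`. All error events live on the reference
configuration. [cite: DKKMO2020Rotational, Thm. 2.1 (q = 1), with v2 Thm. 1.7 and §7.1 pp. 42–43] -/
theorem finiteQuads_of_transfer_of_theorem_1_7_of_continuity
    (hcont : ∀ (Q₀ : Quad (univ : Set ℂ)) (ε : ℝ≥0∞), 0 < ε →
      ∃ Q' Q'' : Quad (univ : Set ℂ), Quad.StrictlyDominated Q' Q₀ ∧ Quad.StrictlyDominated Q₀ Q'' ∧
        ∃ δ₀ : ℝ, 0 < δ₀ ∧ ∀ δ : ℝ, 0 < δ → δ < δ₀ →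
          bondPercolation (zdGraph 2) half
            {ω | (∃ K, Q'.IsCrossing K ∧ K ⊆ openEdgeUnion δ ω) ∧
              ¬ ∃ K, Q''.IsCrossing K ∧ K ⊆ openEdgeUnion δ ω} ≤ ε)
    (H : ∀ (R : ConformalRectangle) (ε : ℝ), 0 < ε → ∃ η : ℝ, 0 < η ∧ ∃ δ₁ : ℝ, 0 < δ₁ ∧
      ∀ α ∈ Set.Ioo (0 : ℝ) π, ∀ δ ∈ Set.Ioo (0 : ℝ) δ₁, ∃ G B : Set (BondConfig (Site 2)),
        (isoRectPercolation (π / 2)).real (quadCrossingEmb (isoRectDrawing (π / 2)) R δ \ G) ≤ ε ∧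
        (isoRectPercolation (π / 2)).real
            ((quadCrossingEmb (isoRectDrawing (π / 2)) R δ)ᶜ \ B) ≤ ε ∧
        (∀ ω ω' : BondConfig (Site 2), ω' ∈ quadCrossingEmb (isoRectDrawing (π / 2)) R δ →
          ω' ∈ G →
          LoopConfig.IsClose η (isoRectLoopConfig δ α ω) (isoRectLoopConfig δ (π / 2) ω') →
          ω ∈ quadCrossingEmb (isoRectDrawing α) R δ) ∧
        (∀ ω ω' : BondConfig (Site 2), ω' ∉ quadCrossingEmb (isoRectDrawing (π / 2)) R δ →
          ω' ∈ B →
          LoopConfig.IsClose η (isoRectLoopConfig δ α ω) (isoRectLoopConfig δ (π / 2) ω') →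
          ω ∉ quadCrossingEmb (isoRectDrawing α) R δ))
    (h17 : dkkmo_theorem_1_7) :
    ∀ ε : ℝ, 0 < ε → ∀ F : Finset (Quad (univ : Set ℂ)),
      ∃ δ₀ : ℝ, 0 < δ₀ ∧ ∀ α ∈ Set.Ioo ε (π - ε), ∀ δ : ℝ, 0 < δ → δ ≤ δ₀ →
        ∃ P : Measure (BondConfig (Site 2) × BondConfig (Site 2)),
          P.map Prod.fst = prodBernoulli (isoRectCriticalProb α) ∧
          P.map Prod.snd = prodBernoulli (isoRectCriticalProb (π / 2)) ∧
          P {p | ∃ Q ∈ F, ¬ (Q ∈ isoRectQuadConfig α δ p.1 ↔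
            Q ∈ isoRectQuadConfig (π / 2) δ p.2)} < ENNReal.ofReal ε := by
  classical
  intro ε hε F
  set n : ℕ := F.card with hn
  have hη₅pos : 0 < ε / (4 * (n + 1)) := by positivity
  have hη₅ : 0 < ENNReal.ofReal (ε / (4 * (n + 1))) := ENNReal.ofReal_pos.2 hη₅pos
  have hε' : 0 < ε / (8 * (n + 1)) := by positivity
  -- per-quad data
  choose η δQ E hη hδQ hE hBad using
    fun Q : Quad (univ : Set ℂ) => exists_events_of_transfer_quad hcont H Q hη₅ hε'
  obtain ⟨η₀, hη₀, hη₀le⟩ := exists_pos_le_of_finite F.finite_toSet fun Q _ => hη Q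
  obtain ⟨δ₂, hδ₂, hδ₂le⟩ := exists_pos_le_of_finite F.finite_toSet fun Q _ => hδQ Q
  -- the coupling of Theorem 1.7
  obtain ⟨c, C, hc, hC, hcoup⟩ := h17.exists_coupling
  have hε4 : 0 < min η₀ (ε / 4) := lt_min hη₀ (by positivity)
  obtain ⟨δ₃, hδ₃, hsmall⟩ := exists_pos_forall_mul_rpow_lt hc hC hε4
  refine ⟨min (δ₂ / 2) (δ₃ / 2), lt_min (by positivity) (by positivity), fun α hα δ hδ hδle => ?_⟩
  have hα0 : α ∈ Set.Ioo 0 π := ⟨hε.trans hα.1, by linarith [hα.2]⟩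
  have hδ₂lt : ∀ Q ∈ F, δ < δQ Q := fun Q hQ =>
    (hδle.trans (min_le_left _ _)).trans_lt ((half_lt_self hδ₂).trans_le (hδ₂le Q hQ))
  have hδ₃lt : δ ∈ Set.Ioo 0 δ₃ := ⟨hδ, (hδle.trans (min_le_right _ _)).trans_lt (half_lt_self hδ₃)⟩
  have hCδ : 0 < C * δ ^ c := by positivity
  have hCδη₀ : C * δ ^ c ≤ η₀ := (hsmall δ hδ₃lt).le.trans (min_le_left _ _)
  have hCδε : C * δ ^ c < ε / 4 := (hsmall δ hδ₃lt).trans_le (min_le_right _ _)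
  obtain ⟨P, hP1, hP2, hPclose⟩ := hcoup α hα0 δ hδ
  haveI : IsProbabilityMeasure P := isProbabilityMeasure_of_map_fst hP1
  refine ⟨P, by rw [hP1, prodBernoulli_isoRectCriticalProb],
    by rw [hP2, prodBernoulli_isoRectCriticalProb], ?_⟩
  -- the bad events of the quads of `F` at `(α, δ)`
  have hBadF : ∀ Q ∈ F, ∃ Bad : Set (BondConfig (Site 2)),
      (isoRectPercolation (π / 2)).real Bad ≤ 2 * (ε / (8 * (n + 1))) ∧
      ∀ ω ω' : BondConfig (Site 2),
        LoopConfig.IsClose (η Q) (isoRectLoopConfig δ α ω) (isoRectLoopConfig δ (π / 2) ω') →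
        ¬ (Q ∈ isoRectQuadConfig α δ ω ↔ Q ∈ isoRectQuadConfig (π / 2) δ ω') →
        ω' ∈ E Q δ ∨ ω' ∈ Bad := fun Q hQ => hBad Q α hα0 δ ⟨hδ, hδ₂lt Q hQ⟩
  choose! Bad hBadle hBadP using hBadF
  -- the closeness event and the inclusion of events
  set Cl : Set (BondConfig (Site 2) × BondConfig (Site 2)) :=
    {p | LoopConfig.IsClose (C * δ ^ c) (isoRectLoopConfig δ α p.1)
      (isoRectLoopConfig δ (π / 2) p.2)} with hCldef
  have hincl : {p : BondConfig (Site 2) × BondConfig (Site 2) | ∃ Q ∈ F,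
      ¬ (Q ∈ isoRectQuadConfig α δ p.1 ↔ Q ∈ isoRectQuadConfig (π / 2) δ p.2)} ⊆
      Clᶜ ∪ ⋃ Q ∈ F, Prod.snd ⁻¹' (E Q δ ∪ Bad Q) := by
    rintro ⟨ω, ω'⟩ ⟨Q, hQF, hdis⟩
    by_cases hCl : (ω, ω') ∈ Cl
    · refine Or.inr (mem_iUnion₂.2 ⟨Q, hQF, ?_⟩)
      have hclose : LoopConfig.IsClose (η Q) (isoRectLoopConfig δ α ω)
          (isoRectLoopConfig δ (π / 2) ω') :=
        LoopConfig.IsClose.mono hCδ (hCδη₀.trans (hη₀le Q hQF)) hCl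
      exact hBadP Q hQF ω ω' hclose hdis
    · exact Or.inl hCl
  -- measure bounds, in real numbers
  have hClbound : P.real Clᶜ < ε / 4 := by
    have : Clᶜ = {p | ¬ LoopConfig.IsClose (C * δ ^ c) (isoRectLoopConfig δ α p.1)
        (isoRectLoopConfig δ (π / 2) p.2)} := rfl
    rw [measureReal_def, this]
    exact (ENNReal.toReal_lt_of_lt_ofReal hPclose).trans hCδε
  have hEbound : ∀ Q ∈ F, (isoRectPercolation (π / 2)).real (E Q δ) ≤ ε / (4 * (n + 1)) := by
    intro Q hQ
    rw [isoRectPercolation_pi_div_two, measureReal_def]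
    exact ENNReal.toReal_le_of_le_ofReal hη₅pos.le (hE Q δ hδ (hδ₂lt Q hQ))
  have hsum : P.real (⋃ Q ∈ F, Prod.snd ⁻¹' (E Q δ ∪ Bad Q)) ≤ ε / 2 := by
    calc P.real (⋃ Q ∈ F, Prod.snd ⁻¹' (E Q δ ∪ Bad Q))
        ≤ ∑ Q ∈ F, P.real (Prod.snd ⁻¹' (E Q δ ∪ Bad Q)) := measureReal_biUnion_finset_le _ _
      _ ≤ ∑ Q ∈ F, (ε / (4 * (n + 1)) + 2 * (ε / (8 * (n + 1)))) :=
          Finset.sum_le_sum fun Q hQ => ?_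
      _ = n * (ε / (2 * (n + 1))) := by
          rw [Finset.sum_const, nsmul_eq_mul, hn]
          have h1 : ((F.card : ℝ) + 1) ≠ 0 := by positivity
          field_simp
          ring
      _ ≤ ε / 2 := by
          rw [← mul_div_assoc, div_le_iff₀ (by positivity)]
          nlinarith [mul_nonneg (Nat.cast_nonneg (α := ℝ) n) hε.le]
    calc P.real (Prod.snd ⁻¹' (E Q δ ∪ Bad Q))
        ≤ (isoRectPercolation (π / 2)).real (E Q δ ∪ Bad Q) :=
          measureReal_preimage_snd_le_of_map_eq hP2 _
      _ ≤ (isoRectPercolation (π / 2)).real (E Q δ) + (isoRectPercolation (π / 2)).real (Bad Q) :=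
          measureReal_union_le _ _
      _ ≤ ε / (4 * (n + 1)) + 2 * (ε / (8 * (n + 1))) := add_le_add (hEbound Q hQ) (hBadle Q hQ)
  have hreal : P.real {p : BondConfig (Site 2) × BondConfig (Site 2) | ∃ Q ∈ F,
      ¬ (Q ∈ isoRectQuadConfig α δ p.1 ↔ Q ∈ isoRectQuadConfig (π / 2) δ p.2)} < ε :=
    calc P.real {p : BondConfig (Site 2) × BondConfig (Site 2) | ∃ Q ∈ F,
          ¬ (Q ∈ isoRectQuadConfig α δ p.1 ↔ Q ∈ isoRectQuadConfig (π / 2) δ p.2)}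
        ≤ P.real (Clᶜ ∪ ⋃ Q ∈ F, Prod.snd ⁻¹' (E Q δ ∪ Bad Q)) := measureReal_mono hincl
      _ ≤ P.real Clᶜ + P.real (⋃ Q ∈ F, Prod.snd ⁻¹' (E Q δ ∪ Bad Q)) := measureReal_union_le _ _
      _ < ε / 4 + ε / 2 := add_lt_add_of_lt_of_le hClbound hsum
      _ ≤ ε := by linarith
  exact (ENNReal.lt_ofReal_iff_toReal_lt (measure_ne_top P _)).2 hreal

/-- **DKKMO Thm. 2.1, `d_SS` half (`q = 1`), from the printed Theorem 1.7 and the per-quad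
loops-to-crossings transfer.** `H` is VERBATIM the hypothesis of
`DKKMO2020_thm21_quadCrossingProb_of_transfer` (`IsoradialRectangularCrossingsTransfer.lean`), so the
configuration-level fact `DKKMO2020_thm21_schrammSmirnov` and its per-quad reading
`DKKMO2020_thm21_quadCrossingProb` rest on the same two inputs; Schramm–Smirnov's (5.1) is supplied
by the discharged `SchrammSmirnov2011_lemma_5_1_holds`. This is the passage "Theorem 1.7 for the
`d_CN` distance ⟹ the statement for the `d_SS` distance" (v2, end of §4.2: "follows by [GPS13,
Sec. 2.3]"; v1, proof of Thm. 2.2: "known implications between the former and the latter") with the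
loops-to-crossings step isolated as `H`.
[cite: DKKMO2020Rotational, Thm. 2.1 (q = 1, d_SS part), with v2 Thm. 1.7 and §7.1 pp. 42–43] -/
theorem DKKMO2020_thm21_schrammSmirnov_of_transfer_of_theorem_1_7
    (H : ∀ (R : ConformalRectangle) (ε : ℝ), 0 < ε → ∃ η : ℝ, 0 < η ∧ ∃ δ₁ : ℝ, 0 < δ₁ ∧
      ∀ α ∈ Set.Ioo (0 : ℝ) π, ∀ δ ∈ Set.Ioo (0 : ℝ) δ₁, ∃ G B : Set (BondConfig (Site 2)),
        (isoRectPercolation (π / 2)).real (quadCrossingEmb (isoRectDrawing (π / 2)) R δ \ G) ≤ ε ∧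
        (isoRectPercolation (π / 2)).real
            ((quadCrossingEmb (isoRectDrawing (π / 2)) R δ)ᶜ \ B) ≤ ε ∧
        (∀ ω ω' : BondConfig (Site 2), ω' ∈ quadCrossingEmb (isoRectDrawing (π / 2)) R δ →
          ω' ∈ G →
          LoopConfig.IsClose η (isoRectLoopConfig δ α ω) (isoRectLoopConfig δ (π / 2) ω') →
          ω ∈ quadCrossingEmb (isoRectDrawing α) R δ) ∧
        (∀ ω ω' : BondConfig (Site 2), ω' ∉ quadCrossingEmb (isoRectDrawing (π / 2)) R δ →
          ω' ∈ B →
          LoopConfig.IsClose η (isoRectLoopConfig δ α ω) (isoRectLoopConfig δ (π / 2) ω') →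
          ω ∉ quadCrossingEmb (isoRectDrawing α) R δ))
    (h17 : dkkmo_theorem_1_7) :
    DKKMO2020_thm21_schrammSmirnov :=
  DKKMO2020_thm21_schrammSmirnov_of_finiteQuads_of_continuity
    (fun Q₀ ε hε => Quad.continuity_of_lemma_5_1 SchrammSmirnov2011_lemma_5_1_holds Q₀ ε hε)
    (finiteQuads_of_transfer_of_theorem_1_7_of_continuity
      (fun Q₀ ε hε => Quad.continuity_of_lemma_5_1 SchrammSmirnov2011_lemma_5_1_holds Q₀ ε hε)
      H h17)

/-! ### The minimal per-quad interface: stable loop-determinacy of the crossing of one quad -/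

/-- **Couplings agreeing on finitely many quads from Theorem 1.7 and per-quad stable
loop-determinacy.** The weakest per-quad input the assembly uses, with no conformal rectangle,
no splitting into robust crossings / non-crossings and no (5.1): (`hLD`) for every quad `Q` and
`κ > 0` there are `η > 0`, `δ₁ > 0` such that for all `α ∈ (0, π)`, `δ ∈ (0, δ₁)` some event `Bad`
of the reference configuration has `φ_{𝕃(π/2)}`-probability `≤ κ` and, off `Bad`, `η`-closeness of
the typed loop ensembles of `ω` on `δ𝕃(α)` and `ω'` on `δ𝕃(π/2)` forces the crossing indicators
of `Q` in `S^{α}_{ω}` and `S^{π/2}_{ω'}` to agree ("the crossing of `Q` is determined by the loop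
ensemble, stably, off an event of small probability of the `ℤ²` configuration"). Under the
coupling of `dkkmo_theorem_1_7` a union bound over the family concludes (`C δ^c ≤ min_Q η_Q`,
`C δ^c < ε/2`, budgets `ε/(2(n+1))`).
[cite: DKKMO2020Rotational, Thm. 2.1 (q = 1), with v2 Thm. 1.7 and §7.1 pp. 42–43] -/
theorem finiteQuads_of_loopDetermined_of_theorem_1_7
    (hLD : ∀ (Q : Quad (univ : Set ℂ)) (κ : ℝ), 0 < κ → ∃ η : ℝ, 0 < η ∧ ∃ δ₁ : ℝ, 0 < δ₁ ∧
      ∀ α ∈ Set.Ioo (0 : ℝ) π, ∀ δ ∈ Set.Ioo (0 : ℝ) δ₁, ∃ Bad : Set (BondConfig (Site 2)),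
        (isoRectPercolation (π / 2)).real Bad ≤ κ ∧
        ∀ ω ω' : BondConfig (Site 2),
          LoopConfig.IsClose η (isoRectLoopConfig δ α ω) (isoRectLoopConfig δ (π / 2) ω') →
          ω' ∉ Bad → (Q ∈ isoRectQuadConfig α δ ω ↔ Q ∈ isoRectQuadConfig (π / 2) δ ω'))
    (h17 : dkkmo_theorem_1_7) :
    ∀ ε : ℝ, 0 < ε → ∀ F : Finset (Quad (univ : Set ℂ)),
      ∃ δ₀ : ℝ, 0 < δ₀ ∧ ∀ α ∈ Set.Ioo ε (π - ε), ∀ δ : ℝ, 0 < δ → δ ≤ δ₀ →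
        ∃ P : Measure (BondConfig (Site 2) × BondConfig (Site 2)),
          P.map Prod.fst = prodBernoulli (isoRectCriticalProb α) ∧
          P.map Prod.snd = prodBernoulli (isoRectCriticalProb (π / 2)) ∧
          P {p | ∃ Q ∈ F, ¬ (Q ∈ isoRectQuadConfig α δ p.1 ↔
            Q ∈ isoRectQuadConfig (π / 2) δ p.2)} < ENNReal.ofReal ε := by
  classical
  intro ε hε F
  set n : ℕ := F.card with hn
  have hκ : 0 < ε / (2 * (n + 1)) := by positivity
  -- per-quad data
  choose η hη δ₁ hδ₁ hBad using fun Q : Quad (univ : Set ℂ) => hLD Q _ hκ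
  obtain ⟨η₀, hη₀, hη₀le⟩ := exists_pos_le_of_finite F.finite_toSet fun Q _ => hη Q
  obtain ⟨δ₂, hδ₂, hδ₂le⟩ := exists_pos_le_of_finite F.finite_toSet fun Q _ => hδ₁ Q
  -- the coupling of Theorem 1.7
  obtain ⟨c, C, hc, hC, hcoup⟩ := h17.exists_coupling
  have hε2 : 0 < min η₀ (ε / 2) := lt_min hη₀ (by positivity)
  obtain ⟨δ₃, hδ₃, hsmall⟩ := exists_pos_forall_mul_rpow_lt hc hC hε2
  refine ⟨min (δ₂ / 2) (δ₃ / 2), lt_min (by positivity) (by positivity), fun α hα δ hδ hδle => ?_⟩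
  have hα0 : α ∈ Set.Ioo 0 π := ⟨hε.trans hα.1, by linarith [hα.2]⟩
  have hδ₂lt : ∀ Q ∈ F, δ < δ₁ Q := fun Q hQ =>
    (hδle.trans (min_le_left _ _)).trans_lt ((half_lt_self hδ₂).trans_le (hδ₂le Q hQ))
  have hδ₃lt : δ ∈ Set.Ioo 0 δ₃ := ⟨hδ, (hδle.trans (min_le_right _ _)).trans_lt (half_lt_self hδ₃)⟩
  have hCδ : 0 < C * δ ^ c := by positivity
  have hCδη₀ : C * δ ^ c ≤ η₀ := (hsmall δ hδ₃lt).le.trans (min_le_left _ _)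
  have hCδε : C * δ ^ c < ε / 2 := (hsmall δ hδ₃lt).trans_le (min_le_right _ _)
  obtain ⟨P, hP1, hP2, hPclose⟩ := hcoup α hα0 δ hδ
  haveI : IsProbabilityMeasure P := isProbabilityMeasure_of_map_fst hP1
  refine ⟨P, by rw [hP1, prodBernoulli_isoRectCriticalProb],
    by rw [hP2, prodBernoulli_isoRectCriticalProb], ?_⟩
  -- the bad events of the quads of `F` at `(α, δ)`
  have hBadF : ∀ Q ∈ F, ∃ Bad : Set (BondConfig (Site 2)),
      (isoRectPercolation (π / 2)).real Bad ≤ ε / (2 * (n + 1)) ∧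
      ∀ ω ω' : BondConfig (Site 2),
        LoopConfig.IsClose (η Q) (isoRectLoopConfig δ α ω) (isoRectLoopConfig δ (π / 2) ω') →
        ω' ∉ Bad → (Q ∈ isoRectQuadConfig α δ ω ↔ Q ∈ isoRectQuadConfig (π / 2) δ ω') :=
    fun Q hQ => hBad Q α hα0 δ ⟨hδ, hδ₂lt Q hQ⟩
  choose! Bad hBadle hBadP using hBadF
  -- the closeness event and the inclusion of events
  set Cl : Set (BondConfig (Site 2) × BondConfig (Site 2)) :=
    {p | LoopConfig.IsClose (C * δ ^ c) (isoRectLoopConfig δ α p.1)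
      (isoRectLoopConfig δ (π / 2) p.2)} with hCldef
  have hincl : {p : BondConfig (Site 2) × BondConfig (Site 2) | ∃ Q ∈ F,
      ¬ (Q ∈ isoRectQuadConfig α δ p.1 ↔ Q ∈ isoRectQuadConfig (π / 2) δ p.2)} ⊆
      Clᶜ ∪ ⋃ Q ∈ F, Prod.snd ⁻¹' Bad Q := by
    rintro ⟨ω, ω'⟩ ⟨Q, hQF, hdis⟩
    by_cases hCl : (ω, ω') ∈ Cl
    · refine Or.inr (mem_iUnion₂.2 ⟨Q, hQF, ?_⟩)
      have hclose : LoopConfig.IsClose (η Q) (isoRectLoopConfig δ α ω)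
          (isoRectLoopConfig δ (π / 2) ω') :=
        LoopConfig.IsClose.mono hCδ (hCδη₀.trans (hη₀le Q hQF)) hCl
      show ω' ∈ Bad Q
      by_contra hω'
      exact hdis (hBadP Q hQF ω ω' hclose hω')
    · exact Or.inl hCl
  -- measure bounds, in real numbers
  have hClbound : P.real Clᶜ < ε / 2 := by
    have : Clᶜ = {p | ¬ LoopConfig.IsClose (C * δ ^ c) (isoRectLoopConfig δ α p.1)
        (isoRectLoopConfig δ (π / 2) p.2)} := rfl
    rw [measureReal_def, this]
    exact (ENNReal.toReal_lt_of_lt_ofReal hPclose).trans hCδε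
  have hsum : P.real (⋃ Q ∈ F, Prod.snd ⁻¹' Bad Q) ≤ ε / 2 := by
    calc P.real (⋃ Q ∈ F, Prod.snd ⁻¹' Bad Q)
        ≤ ∑ Q ∈ F, P.real (Prod.snd ⁻¹' Bad Q) := measureReal_biUnion_finset_le _ _
      _ ≤ ∑ Q ∈ F, ε / (2 * (n + 1)) := Finset.sum_le_sum fun Q hQ =>
          (measureReal_preimage_snd_le_of_map_eq hP2 _).trans (hBadle Q hQ)
      _ = n * (ε / (2 * (n + 1))) := by rw [Finset.sum_const, nsmul_eq_mul, hn]
      _ ≤ ε / 2 := by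
          rw [← mul_div_assoc, div_le_iff₀ (by positivity)]
          nlinarith [mul_nonneg (Nat.cast_nonneg (α := ℝ) n) hε.le]
  have hreal : P.real {p : BondConfig (Site 2) × BondConfig (Site 2) | ∃ Q ∈ F,
      ¬ (Q ∈ isoRectQuadConfig α δ p.1 ↔ Q ∈ isoRectQuadConfig (π / 2) δ p.2)} < ε :=
    calc P.real {p : BondConfig (Site 2) × BondConfig (Site 2) | ∃ Q ∈ F,
          ¬ (Q ∈ isoRectQuadConfig α δ p.1 ↔ Q ∈ isoRectQuadConfig (π / 2) δ p.2)}
        ≤ P.real (Clᶜ ∪ ⋃ Q ∈ F, Prod.snd ⁻¹' Bad Q) := measureReal_mono hincl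
      _ ≤ P.real Clᶜ + P.real (⋃ Q ∈ F, Prod.snd ⁻¹' Bad Q) := measureReal_union_le _ _
      _ < ε / 2 + ε / 2 := add_lt_add_of_lt_of_le hClbound hsum
      _ = ε := add_halves ε
  exact (ENNReal.lt_ofReal_iff_toReal_lt (measure_ne_top P _)).2 hreal

/-- **The per-quad transfer `H` (with (5.1)) gives stable loop-determinacy.** The hypothesis `hLD`
of `finiteQuads_of_loopDetermined_of_theorem_1_7` follows from `H` and (5.1): take the data of
`exists_events_of_transfer_quad` with budgets `κ/2` for (5.1) and `κ/4` for the transfer, and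
`Bad' = E_δ ∪ Bad` (probability `≤ κ/2 + 2·κ/4 = κ`).
[cite: DKKMO2020Rotational, Thm. 2.1 (q = 1), §5.2 p. 25 and §7.1 pp. 42–43] -/
theorem loopDetermined_of_transfer_of_continuity
    (hcont : ∀ (Q₀ : Quad (univ : Set ℂ)) (ε : ℝ≥0∞), 0 < ε →
      ∃ Q' Q'' : Quad (univ : Set ℂ), Quad.StrictlyDominated Q' Q₀ ∧ Quad.StrictlyDominated Q₀ Q'' ∧
        ∃ δ₀ : ℝ, 0 < δ₀ ∧ ∀ δ : ℝ, 0 < δ → δ < δ₀ →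
          bondPercolation (zdGraph 2) half
            {ω | (∃ K, Q'.IsCrossing K ∧ K ⊆ openEdgeUnion δ ω) ∧
              ¬ ∃ K, Q''.IsCrossing K ∧ K ⊆ openEdgeUnion δ ω} ≤ ε)
    (H : ∀ (R : ConformalRectangle) (ε : ℝ), 0 < ε → ∃ η : ℝ, 0 < η ∧ ∃ δ₁ : ℝ, 0 < δ₁ ∧
      ∀ α ∈ Set.Ioo (0 : ℝ) π, ∀ δ ∈ Set.Ioo (0 : ℝ) δ₁, ∃ G B : Set (BondConfig (Site 2)),
        (isoRectPercolation (π / 2)).real (quadCrossingEmb (isoRectDrawing (π / 2)) R δ \ G) ≤ ε ∧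
        (isoRectPercolation (π / 2)).real
            ((quadCrossingEmb (isoRectDrawing (π / 2)) R δ)ᶜ \ B) ≤ ε ∧
        (∀ ω ω' : BondConfig (Site 2), ω' ∈ quadCrossingEmb (isoRectDrawing (π / 2)) R δ →
          ω' ∈ G →
          LoopConfig.IsClose η (isoRectLoopConfig δ α ω) (isoRectLoopConfig δ (π / 2) ω') →
          ω ∈ quadCrossingEmb (isoRectDrawing α) R δ) ∧
        (∀ ω ω' : BondConfig (Site 2), ω' ∉ quadCrossingEmb (isoRectDrawing (π / 2)) R δ →
          ω' ∈ B →
          LoopConfig.IsClose η (isoRectLoopConfig δ α ω) (isoRectLoopConfig δ (π / 2) ω') →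
          ω ∉ quadCrossingEmb (isoRectDrawing α) R δ)) :
    ∀ (Q : Quad (univ : Set ℂ)) (κ : ℝ), 0 < κ → ∃ η : ℝ, 0 < η ∧ ∃ δ₁ : ℝ, 0 < δ₁ ∧
      ∀ α ∈ Set.Ioo (0 : ℝ) π, ∀ δ ∈ Set.Ioo (0 : ℝ) δ₁, ∃ Bad : Set (BondConfig (Site 2)),
        (isoRectPercolation (π / 2)).real Bad ≤ κ ∧
        ∀ ω ω' : BondConfig (Site 2),
          LoopConfig.IsClose η (isoRectLoopConfig δ α ω) (isoRectLoopConfig δ (π / 2) ω') →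
          ω' ∉ Bad → (Q ∈ isoRectQuadConfig α δ ω ↔ Q ∈ isoRectQuadConfig (π / 2) δ ω') := by
  intro Q κ hκ
  have hκ2 : 0 < κ / 2 := by positivity
  have hκ4 : 0 < κ / 4 := by positivity
  obtain ⟨η, δQ, E, hη, hδQ, hE, hBad⟩ :=
    exists_events_of_transfer_quad hcont H Q (ENNReal.ofReal_pos.2 hκ2) hκ4
  refine ⟨η, hη, δQ, hδQ, fun α hα δ hδ => ?_⟩
  obtain ⟨Bad, hBadle, hBadP⟩ := hBad α hα δ hδ
  refine ⟨E δ ∪ Bad, ?_, fun ω ω' hclose hω' => ?_⟩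
  · have hEle : (isoRectPercolation (π / 2)).real (E δ) ≤ κ / 2 := by
      rw [isoRectPercolation_pi_div_two, measureReal_def]
      exact ENNReal.toReal_le_of_le_ofReal hκ2.le (hE δ hδ.1 hδ.2)
    calc (isoRectPercolation (π / 2)).real (E δ ∪ Bad)
        ≤ (isoRectPercolation (π / 2)).real (E δ) + (isoRectPercolation (π / 2)).real Bad :=
          measureReal_union_le _ _
      _ ≤ κ / 2 + 2 * (κ / 4) := add_le_add hEle hBadle
      _ = κ := by ring
  · by_contra hdis
    rcases hBadP ω ω' hclose hdis with h | h
    · exact hω' (Or.inl h)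
    · exact hω' (Or.inr h)

/-- **DKKMO Thm. 2.1, `d_SS` half (`q = 1`), from Theorem 1.7 and per-quad stable
loop-determinacy** (the minimal interface: `finiteQuads_of_loopDetermined_of_theorem_1_7` and
`DKKMO2020_thm21_schrammSmirnov_iff_finiteQuads`).
[cite: DKKMO2020Rotational, Thm. 2.1 (q = 1, d_SS part), with v2 Thm. 1.7 and §7.1 pp. 42–43] -/
theorem DKKMO2020_thm21_schrammSmirnov_of_loopDetermined_of_theorem_1_7
    (hLD : ∀ (Q : Quad (univ : Set ℂ)) (κ : ℝ), 0 < κ → ∃ η : ℝ, 0 < η ∧ ∃ δ₁ : ℝ, 0 < δ₁ ∧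
      ∀ α ∈ Set.Ioo (0 : ℝ) π, ∀ δ ∈ Set.Ioo (0 : ℝ) δ₁, ∃ Bad : Set (BondConfig (Site 2)),
        (isoRectPercolation (π / 2)).real Bad ≤ κ ∧
        ∀ ω ω' : BondConfig (Site 2),
          LoopConfig.IsClose η (isoRectLoopConfig δ α ω) (isoRectLoopConfig δ (π / 2) ω') →
          ω' ∉ Bad → (Q ∈ isoRectQuadConfig α δ ω ↔ Q ∈ isoRectQuadConfig (π / 2) δ ω'))
    (h17 : dkkmo_theorem_1_7) :
    DKKMO2020_thm21_schrammSmirnov :=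
  DKKMO2020_thm21_schrammSmirnov_iff_finiteQuads.2
    (finiteQuads_of_loopDetermined_of_theorem_1_7 hLD h17)

/-! ### The most general per-quad interface: bad events on both lattices, angles in a window -/

/-- **Couplings agreeing on finitely many quads from Theorem 1.7 and per-quad loop-determinacy
with bad events on BOTH configurations and angles in a window.** The hypothesis `hLD₂` only asks,
for every quad `Q`, budget `κ > 0` and angle window `(ε', π - ε')`, for `η > 0`, `δ₁ > 0` and,
for each `α` in the window and `δ ∈ (0, δ₁)`, events `Bad₁` of the `𝕃(α)` configuration
(`φ_{𝕃(α)}`-probability `≤ κ`) and `Bad₂` of the reference configuration (`φ_{𝕃(π/2)}`-probability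
`≤ κ`) off which `η`-closeness of the typed loop ensembles forces the crossing indicators of `Q` to
agree — so percolation estimates on `𝕃(α)` uniform over bounded angles (Grimmett–Manolescu) may be
spent on the first coordinate. Same union bound as `finiteQuads_of_loopDetermined_of_theorem_1_7`
(budget `ε/(4(n+1))` per bad event, `C δ^c < ε/2`, window `ε' = ε`).
[cite: DKKMO2020Rotational, Thm. 2.1 (q = 1), with v2 Thm. 1.7 and §7.1 pp. 42–43] -/
theorem finiteQuads_of_loopDetermined₂_of_theorem_1_7
    (hLD₂ : ∀ (Q : Quad (univ : Set ℂ)) (κ : ℝ), 0 < κ → ∀ ε' : ℝ, 0 < ε' →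
      ∃ η : ℝ, 0 < η ∧ ∃ δ₁ : ℝ, 0 < δ₁ ∧
      ∀ α ∈ Set.Ioo ε' (π - ε'), ∀ δ ∈ Set.Ioo (0 : ℝ) δ₁,
        ∃ Bad₁ Bad₂ : Set (BondConfig (Site 2)),
        (isoRectPercolation α).real Bad₁ ≤ κ ∧ (isoRectPercolation (π / 2)).real Bad₂ ≤ κ ∧
        ∀ ω ω' : BondConfig (Site 2),
          LoopConfig.IsClose η (isoRectLoopConfig δ α ω) (isoRectLoopConfig δ (π / 2) ω') →
          ω ∉ Bad₁ → ω' ∉ Bad₂ →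
            (Q ∈ isoRectQuadConfig α δ ω ↔ Q ∈ isoRectQuadConfig (π / 2) δ ω'))
    (h17 : dkkmo_theorem_1_7) :
    ∀ ε : ℝ, 0 < ε → ∀ F : Finset (Quad (univ : Set ℂ)),
      ∃ δ₀ : ℝ, 0 < δ₀ ∧ ∀ α ∈ Set.Ioo ε (π - ε), ∀ δ : ℝ, 0 < δ → δ ≤ δ₀ →
        ∃ P : Measure (BondConfig (Site 2) × BondConfig (Site 2)),
          P.map Prod.fst = prodBernoulli (isoRectCriticalProb α) ∧
          P.map Prod.snd = prodBernoulli (isoRectCriticalProb (π / 2)) ∧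
          P {p | ∃ Q ∈ F, ¬ (Q ∈ isoRectQuadConfig α δ p.1 ↔
            Q ∈ isoRectQuadConfig (π / 2) δ p.2)} < ENNReal.ofReal ε := by
  classical
  intro ε hε F
  set n : ℕ := F.card with hn
  have hκ : 0 < ε / (4 * (n + 1)) := by positivity
  -- per-quad data, in the window `(ε, π - ε)`
  choose η hη δ₁ hδ₁ hBad using fun Q : Quad (univ : Set ℂ) => hLD₂ Q _ hκ ε hε
  obtain ⟨η₀, hη₀, hη₀le⟩ := exists_pos_le_of_finite F.finite_toSet fun Q _ => hη Q
  obtain ⟨δ₂, hδ₂, hδ₂le⟩ := exists_pos_le_of_finite F.finite_toSet fun Q _ => hδ₁ Q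
  -- the coupling of Theorem 1.7
  obtain ⟨c, C, hc, hC, hcoup⟩ := h17.exists_coupling
  have hε2 : 0 < min η₀ (ε / 2) := lt_min hη₀ (by positivity)
  obtain ⟨δ₃, hδ₃, hsmall⟩ := exists_pos_forall_mul_rpow_lt hc hC hε2
  refine ⟨min (δ₂ / 2) (δ₃ / 2), lt_min (by positivity) (by positivity), fun α hα δ hδ hδle => ?_⟩
  have hα0 : α ∈ Set.Ioo 0 π := ⟨hε.trans hα.1, by linarith [hα.2]⟩
  have hδ₂lt : ∀ Q ∈ F, δ < δ₁ Q := fun Q hQ =>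
    (hδle.trans (min_le_left _ _)).trans_lt ((half_lt_self hδ₂).trans_le (hδ₂le Q hQ))
  have hδ₃lt : δ ∈ Set.Ioo 0 δ₃ := ⟨hδ, (hδle.trans (min_le_right _ _)).trans_lt (half_lt_self hδ₃)⟩
  have hCδ : 0 < C * δ ^ c := by positivity
  have hCδη₀ : C * δ ^ c ≤ η₀ := (hsmall δ hδ₃lt).le.trans (min_le_left _ _)
  have hCδε : C * δ ^ c < ε / 2 := (hsmall δ hδ₃lt).trans_le (min_le_right _ _)
  obtain ⟨P, hP1, hP2, hPclose⟩ := hcoup α hα0 δ hδ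
  haveI : IsProbabilityMeasure P := isProbabilityMeasure_of_map_fst hP1
  refine ⟨P, by rw [hP1, prodBernoulli_isoRectCriticalProb],
    by rw [hP2, prodBernoulli_isoRectCriticalProb], ?_⟩
  -- the bad events of the quads of `F` at `(α, δ)`
  have hBadF : ∀ Q ∈ F, ∃ Bad₁ Bad₂ : Set (BondConfig (Site 2)),
      (isoRectPercolation α).real Bad₁ ≤ ε / (4 * (n + 1)) ∧
      (isoRectPercolation (π / 2)).real Bad₂ ≤ ε / (4 * (n + 1)) ∧
      ∀ ω ω' : BondConfig (Site 2),
        LoopConfig.IsClose (η Q) (isoRectLoopConfig δ α ω) (isoRectLoopConfig δ (π / 2) ω') →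
        ω ∉ Bad₁ → ω' ∉ Bad₂ →
          (Q ∈ isoRectQuadConfig α δ ω ↔ Q ∈ isoRectQuadConfig (π / 2) δ ω') :=
    fun Q hQ => hBad Q α hα δ ⟨hδ, hδ₂lt Q hQ⟩
  choose! Bad₁ Bad₂ hBad₁le hBad₂le hBadP using hBadF
  -- the closeness event and the inclusion of events
  set Cl : Set (BondConfig (Site 2) × BondConfig (Site 2)) :=
    {p | LoopConfig.IsClose (C * δ ^ c) (isoRectLoopConfig δ α p.1)
      (isoRectLoopConfig δ (π / 2) p.2)} with hCldef
  have hincl : {p : BondConfig (Site 2) × BondConfig (Site 2) | ∃ Q ∈ F,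
      ¬ (Q ∈ isoRectQuadConfig α δ p.1 ↔ Q ∈ isoRectQuadConfig (π / 2) δ p.2)} ⊆
      Clᶜ ∪ ⋃ Q ∈ F, (Prod.fst ⁻¹' Bad₁ Q ∪ Prod.snd ⁻¹' Bad₂ Q) := by
    rintro ⟨ω, ω'⟩ ⟨Q, hQF, hdis⟩
    by_cases hCl : (ω, ω') ∈ Cl
    · refine Or.inr (mem_iUnion₂.2 ⟨Q, hQF, ?_⟩)
      have hclose : LoopConfig.IsClose (η Q) (isoRectLoopConfig δ α ω)
          (isoRectLoopConfig δ (π / 2) ω') :=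
        LoopConfig.IsClose.mono hCδ (hCδη₀.trans (hη₀le Q hQF)) hCl
      by_contra hboth
      simp only [mem_union, mem_preimage, not_or] at hboth
      exact hdis (hBadP Q hQF ω ω' hclose hboth.1 hboth.2)
    · exact Or.inl hCl
  -- measure bounds, in real numbers
  have hClbound : P.real Clᶜ < ε / 2 := by
    have : Clᶜ = {p | ¬ LoopConfig.IsClose (C * δ ^ c) (isoRectLoopConfig δ α p.1)
        (isoRectLoopConfig δ (π / 2) p.2)} := rfl
    rw [measureReal_def, this]
    exact (ENNReal.toReal_lt_of_lt_ofReal hPclose).trans hCδε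
  have hsum : P.real (⋃ Q ∈ F, (Prod.fst ⁻¹' Bad₁ Q ∪ Prod.snd ⁻¹' Bad₂ Q)) ≤ ε / 2 := by
    calc P.real (⋃ Q ∈ F, (Prod.fst ⁻¹' Bad₁ Q ∪ Prod.snd ⁻¹' Bad₂ Q))
        ≤ ∑ Q ∈ F, P.real (Prod.fst ⁻¹' Bad₁ Q ∪ Prod.snd ⁻¹' Bad₂ Q) :=
          measureReal_biUnion_finset_le _ _
      _ ≤ ∑ Q ∈ F, (ε / (4 * (n + 1)) + ε / (4 * (n + 1))) := Finset.sum_le_sum fun Q hQ =>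
          (measureReal_union_le _ _).trans (add_le_add
            ((measureReal_preimage_fst_le_of_map_eq hP1 _).trans (hBad₁le Q hQ))
            ((measureReal_preimage_snd_le_of_map_eq hP2 _).trans (hBad₂le Q hQ)))
      _ = n * (ε / (2 * (n + 1))) := by
          rw [Finset.sum_const, nsmul_eq_mul, hn]
          have h1 : ((F.card : ℝ) + 1) ≠ 0 := by positivity
          field_simp
          ring
      _ ≤ ε / 2 := by
          rw [← mul_div_assoc, div_le_iff₀ (by positivity)]
          nlinarith [mul_nonneg (Nat.cast_nonneg (α := ℝ) n) hε.le]
  have hreal : P.real {p : BondConfig (Site 2) × BondConfig (Site 2) | ∃ Q ∈ F,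
      ¬ (Q ∈ isoRectQuadConfig α δ p.1 ↔ Q ∈ isoRectQuadConfig (π / 2) δ p.2)} < ε :=
    calc P.real {p : BondConfig (Site 2) × BondConfig (Site 2) | ∃ Q ∈ F,
          ¬ (Q ∈ isoRectQuadConfig α δ p.1 ↔ Q ∈ isoRectQuadConfig (π / 2) δ p.2)}
        ≤ P.real (Clᶜ ∪ ⋃ Q ∈ F, (Prod.fst ⁻¹' Bad₁ Q ∪ Prod.snd ⁻¹' Bad₂ Q)) :=
          measureReal_mono hincl
      _ ≤ P.real Clᶜ + P.real (⋃ Q ∈ F, (Prod.fst ⁻¹' Bad₁ Q ∪ Prod.snd ⁻¹' Bad₂ Q)) :=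
          measureReal_union_le _ _
      _ < ε / 2 + ε / 2 := add_lt_add_of_lt_of_le hClbound hsum
      _ = ε := add_halves ε
  exact (ENNReal.lt_ofReal_iff_toReal_lt (measure_ne_top P _)).2 hreal

/-- **DKKMO Thm. 2.1, `d_SS` half (`q = 1`), from Theorem 1.7 and the two-sided windowed
per-quad loop-determinacy** (`finiteQuads_of_loopDetermined₂_of_theorem_1_7` and
`DKKMO2020_thm21_schrammSmirnov_iff_finiteQuads`).
[cite: DKKMO2020Rotational, Thm. 2.1 (q = 1, d_SS part), with v2 Thm. 1.7 and §7.1 pp. 42–43] -/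
theorem DKKMO2020_thm21_schrammSmirnov_of_loopDetermined₂_of_theorem_1_7
    (hLD₂ : ∀ (Q : Quad (univ : Set ℂ)) (κ : ℝ), 0 < κ → ∀ ε' : ℝ, 0 < ε' →
      ∃ η : ℝ, 0 < η ∧ ∃ δ₁ : ℝ, 0 < δ₁ ∧
      ∀ α ∈ Set.Ioo ε' (π - ε'), ∀ δ ∈ Set.Ioo (0 : ℝ) δ₁,
        ∃ Bad₁ Bad₂ : Set (BondConfig (Site 2)),
        (isoRectPercolation α).real Bad₁ ≤ κ ∧ (isoRectPercolation (π / 2)).real Bad₂ ≤ κ ∧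
        ∀ ω ω' : BondConfig (Site 2),
          LoopConfig.IsClose η (isoRectLoopConfig δ α ω) (isoRectLoopConfig δ (π / 2) ω') →
          ω ∉ Bad₁ → ω' ∉ Bad₂ →
            (Q ∈ isoRectQuadConfig α δ ω ↔ Q ∈ isoRectQuadConfig (π / 2) δ ω'))
    (h17 : dkkmo_theorem_1_7) :
    DKKMO2020_thm21_schrammSmirnov :=
  DKKMO2020_thm21_schrammSmirnov_iff_finiteQuads.2
    (finiteQuads_of_loopDetermined₂_of_theorem_1_7 hLD₂ h17)

/-- The one-sided all-angles loop-determinacy `hLD` of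
`finiteQuads_of_loopDetermined_of_theorem_1_7` is a special case of the two-sided windowed one
(`Bad₁ = ∅`). [folklore] -/
theorem loopDetermined₂_of_loopDetermined
    (hLD : ∀ (Q : Quad (univ : Set ℂ)) (κ : ℝ), 0 < κ → ∃ η : ℝ, 0 < η ∧ ∃ δ₁ : ℝ, 0 < δ₁ ∧
      ∀ α ∈ Set.Ioo (0 : ℝ) π, ∀ δ ∈ Set.Ioo (0 : ℝ) δ₁, ∃ Bad : Set (BondConfig (Site 2)),
        (isoRectPercolation (π / 2)).real Bad ≤ κ ∧
        ∀ ω ω' : BondConfig (Site 2),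
          LoopConfig.IsClose η (isoRectLoopConfig δ α ω) (isoRectLoopConfig δ (π / 2) ω') →
          ω' ∉ Bad → (Q ∈ isoRectQuadConfig α δ ω ↔ Q ∈ isoRectQuadConfig (π / 2) δ ω')) :
    ∀ (Q : Quad (univ : Set ℂ)) (κ : ℝ), 0 < κ → ∀ ε' : ℝ, 0 < ε' →
      ∃ η : ℝ, 0 < η ∧ ∃ δ₁ : ℝ, 0 < δ₁ ∧
      ∀ α ∈ Set.Ioo ε' (π - ε'), ∀ δ ∈ Set.Ioo (0 : ℝ) δ₁,
        ∃ Bad₁ Bad₂ : Set (BondConfig (Site 2)),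
        (isoRectPercolation α).real Bad₁ ≤ κ ∧ (isoRectPercolation (π / 2)).real Bad₂ ≤ κ ∧
        ∀ ω ω' : BondConfig (Site 2),
          LoopConfig.IsClose η (isoRectLoopConfig δ α ω) (isoRectLoopConfig δ (π / 2) ω') →
          ω ∉ Bad₁ → ω' ∉ Bad₂ →
            (Q ∈ isoRectQuadConfig α δ ω ↔ Q ∈ isoRectQuadConfig (π / 2) δ ω') := by
  intro Q κ hκ ε' hε'
  obtain ⟨η, hη, δ₁, hδ₁, h⟩ := hLD Q κ hκ
  refine ⟨η, hη, δ₁, hδ₁, fun α hα δ hδ => ?_⟩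
  obtain ⟨Bad, hBadle, hBadP⟩ := h α ⟨hε'.trans hα.1, by linarith [hα.2]⟩ δ hδ
  refine ⟨∅, Bad, by simp [hκ.le], hBadle, fun ω ω' hclose _ hω' => hBadP ω ω' hclose hω'⟩

end Literature.Probability.Percolation

end
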